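import Literature.NumberTheory.Transcendental.TwoCurveStd
import Literature.NumberTheory.Transcendental.StdSubgroups
import HarnessLib

/-!
# The Semistability Theorem for the two-lattice standard models from its stable case (subgroup transport and induction)

Topic `Literature/NumberTheory/Transcendental`; fourth file of the unit
`provefact-Literature.NumberTheory.Transcendental.H-a66b67e3eb` (fact
`Literature.NumberTheory.Transcendental.HuberWustholzTwoCurvePeriods`, `TwoCurvePeriods.lean`),
after `TwoCurveStd.lean`. It introduces NO named fact. It is the two-lattice counterpart of the
one-lattice files `StdSubgroups.lean` (connected algebraic subgroups `K₀` of `M_κ` are again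
standard models), `SemistableNoSubgroup.lean` and `SemistabilityInduction.lean` (the Semistability
Theorem at points with torsion abelian part by strong induction on `dim M`), for the two-lattice
standard models `M = 𝔾ₘ^β × P` of `TwoCurveStd.lean` (`P` the push-out of the universal vectorial
extension of `E^γ × E'^{γ'}` along `κ`; `E`, `E'` over `ℚ̄`, without CM, not isogenous).

## What is proved here (everything; no `sorry`, no new `def … : Prop`)

* `GaGmEE.Std.Semistable.finrank_eq_zero_of_le` — a semistable proper `𝔟` contains no non-zero
  algebraic Lie subalgebra (Baker–Wüstholz 2007, §6.7);
* bookkeeping for block families (`blockFamily_*`, row/column sums, `sum_blockFamily_col_lat`: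
  a column of a block-diagonal integer family pairs only the rows of its own isotypic block, so
  periods of `Λ` stay periods of `Λ`, those of `Λ'` of `Λ'`);
* `GaGmEE.Std.SubData` — coordinates on `K₀ = H_{(A₀,C₀,C₀',Ξ₀)}` presenting it as a two-lattice
  standard model: unimodular integer families `a⁽ʲ⁾` (spanning `A₀^⊥`), `m⁽ᵇ⁾` (spanning
  `C₀^⊥ ⊆ ℚ^γ`) and `m'⁽ᵇ'⁾` (spanning `C₀'^⊥ ⊆ ℚ^{γ'}`) with integer left inverses — SEPARATELY on
  the two isotypic blocks, the abelian subvariety cut out by `C₀ × C₀'` being `E^{n_C} × E'^{n_{C'}}`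
  — a `ℚ̄`-basis `σ⁽ᵉ⁾` of `Ξ₀^⊥` and the push-out matrix `κ'` (`exists_κS`, `nonempty_subData`);
  the embedding `ι` (`ι_injective`, `ι_mem_tangent`, `exists_eq_ι`, `range_ι`, `card_eq`),
  `ι_mem_ker`, `mem_AlgTors_of_ι` (algebraic points of `K₀` with torsion abelian part come from
  such points of its model), `isKRational_comap`, `finrank_comap`, the push-forward `push` of
  subgroups of the model to subgroups of `M` inside `K₀` (`form_mem_span_C`: double annihilator
  of `C₀ × C₀'`; `prodSub_comap`, `evvC_pccLin`: products are preserved), `push_tangent`, and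
  `SubData.transport`: for a semistable `ℚ̄`-rational proper `𝔟` and a BORDERLINE `0 ≠ K₀ ≠ M`,
  `ι⁻¹(𝔟)` is `ℚ̄`-rational, proper and semistable in the model of `K₀` (verbatim from
  `GaGmE.Std.SubData.transport`);
* `GaGmEE.Std.mem_ker_of_semistable_card` — **the Semistability Theorem for the two-lattice
  standard models at points with torsion abelian part, by strong induction on `dim M`, from its
  STABLE case** (the explicit hypothesis `hclose`): over a borderline `K₀`, the quotient `M/K₀`
  (`QuotData.transport`, `TwoCurveStd.lean`) at all division points `w/m` gives `w ∈ Lie K₀` by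
  discreteness, then the subgroup `K₀` (`SubData.transport`) — Baker–Wüstholz 2007, §6.8, p. 115,
  the passage to `G^*` and to `B ∩ ker π`, as in the one-lattice `SemistabilityInduction.lean`;
* `GaGmEE.Std.semistabilityTheorem_std_tors_of_stableClosing` and
  **`HuberWustholzTwoCurvePeriods_of_stableClosing`: the ten 1-periods
  `1, 2πi, ω₁, ω₂, η₁, η₂, ω₁', ω₂', η₁', η₂'` are `ℚ̄`-linearly independent granted the STABLE case
  of Baker–Wüstholz's Thm. 6.15 for the two-lattice standard models at points with torsion abelian
  part** (inline hypothesis, D-0026).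

## The hypothesis `hclose` and what remains

`hclose` is Thm. 6.15 of Baker–Wüstholz 2007 for `G = M` a two-lattice standard model,
`B = exp(𝔟_ℂ)` with `𝔟 ⊊ Lie M` `ℚ̄`-rational and semistable (op. cit. §6.7, through the list
`algLie` of connected algebraic subgroups, complete for `E`, `E'` non-CM and non-isogenous),
restricted (i) to the algebraic points of `B` over torsion points of `E^γ × E'^{γ'}` and (ii) to
STABLE `𝔟`: no connected algebraic `0 ≠ K ≠ M` with `ℚ̄`-data is borderline,
`dim 𝔟·(n - dim 𝔨) ≠ (dim 𝔟 - dim(𝔟 ∩ 𝔨))·n` — a special case of the printed theorem, nothing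
stronger. For ONE lattice it is `StableClosing.mem_ker_of_stable`, proved in the tree from
Philippon's zero estimate `philippon1986_std` by two runs of Baker's method
(`NumCondFamily.dichotomy'`, `TorsionDichotomy.torsionDichotomy`); the discharge of
`HuberWustholzTwoCurvePeriods` needs exactly that argument on `M` (theta model of `P`, Siegel,
extrapolation, Liouville, the two dichotomies, and Philippon 1986, Thm. 2.1 for `M` in its theta
embedding).

## References

* A. Baker, G. Wüstholz, *Logarithmic Forms and Diophantine Geometry*, New Math. Monogr. 9, CUP
  2007: Thm. 6.15, §6.7 (index, semistability), §6.8 (p. 115: induction over `G^*` and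
  `B ∩ ker π`; pp. 116–119). [BakerWustholz2007]
* A. Huber, G. Wüstholz, *Transcendence and Linear Relations of 1-Periods*, Cambridge Tracts 227,
  CUP 2022: Thm. 15.3 (1) (p. 145), Thm. 6.2. [HuberWustholz2022]
-/

noncomputable section

open Complex Module Submodule

namespace Literature.NumberTheory.Transcendental

namespace GaGmEE

namespace Std

open LiePresentation
open GaGmE (Kbar exists_unimodular_basis linearIndependent_ofK)
open GaGmE.Std (iy iz is coords coords_iy coords_iz coords_is sum_blocks perpQ perpK
  exists_unimodular_with_leftInverse exists_sv isAlgebraic_coe_Kbar eq_zero_of_index_le_of_lt)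

variable {β γ γ' δ : Type}

/-! ### A semistable proper subspace contains no non-zero algebraic Lie subalgebra -/

section NoSubgroup

variable [Fintype β] [Fintype γ] [Fintype γ'] [Fintype δ] {κM : δ → γ ⊕ γ' → Kbar}

/-- **No non-zero algebraic Lie subalgebra inside a semistable proper subspace** (`ℚ̄`-data):
the index inequality with `𝔟 ∩ 𝔨 = 𝔨` forces `dim 𝔨 = 0` (as `GaGmE.Std.Semistable.finrank_eq_zero_of_le`).
[cite: BakerWustholz2007, §6.7 (index and semistability)] -/
theorem Semistable.finrank_eq_zero_of_le {𝔟 : Submodule ℂ (β ⊕ ((γ ⊕ γ') ⊕ δ) → ℂ)}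
    (hss : Semistable κM 𝔟) (h𝔟 : 𝔟 ≠ ⊤) (D : SubgroupData β γ γ' δ κM) (hle : D.tangent ≤ 𝔟) :
    Module.finrank ℂ D.tangent = 0 := by
  have hDtop : D.tangent ≠ ⊤ := fun h => h𝔟 (eq_top_iff.mpr (h ▸ hle))
  have hineq := hss D.tangent ⟨D, rfl⟩ hDtop
  rw [inf_eq_right.mpr hle] at hineq
  have hkb : Module.finrank ℂ D.tangent ≤ Module.finrank ℂ 𝔟 := Submodule.finrank_mono hle
  have hbn : Module.finrank ℂ 𝔟 < Fintype.card (β ⊕ ((γ ⊕ γ') ⊕ δ)) := by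
    have h1 : Module.finrank ℂ 𝔟 < Module.finrank ℂ (β ⊕ ((γ ⊕ γ') ⊕ δ) → ℂ) :=
      Submodule.finrank_lt h𝔟
    simpa using h1
  exact eq_zero_of_index_le_of_lt hkb hbn hineq

end NoSubgroup

/-! ### Block families: bookkeeping -/

section BlockFamily

variable {nC nC' : ℕ} (cv : Fin nC → γ → ℤ) (cv' : Fin nC' → γ' → ℤ)

/-- Block `(E, E)`. [folklore] -/
@[simp] theorem blockFamily_inl_inl (b : Fin nC) (k : γ) :
    blockFamily cv cv' (Sum.inl b) (Sum.inl k) = cv b k := rfl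
/-- Block `(E, E')` is zero. [folklore] -/
@[simp] theorem blockFamily_inl_inr (b : Fin nC) (k : γ') :
    blockFamily cv cv' (Sum.inl b) (Sum.inr k) = 0 := rfl
/-- Block `(E', E)` is zero. [folklore] -/
@[simp] theorem blockFamily_inr_inl (b : Fin nC') (k : γ) :
    blockFamily cv cv' (Sum.inr b) (Sum.inl k) = 0 := rfl
/-- Block `(E', E')`. [folklore] -/
@[simp] theorem blockFamily_inr_inr (b : Fin nC') (k : γ') :
    blockFamily cv cv' (Sum.inr b) (Sum.inr k) = cv' b k := rfl

variable [Fintype γ] [Fintype γ']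

/-- Row sums, `E`-rows. [folklore] -/
theorem sum_blockFamily_inl {R : Type*} [CommRing R] (f : γ ⊕ γ' → R) (b : Fin nC) :
    ∑ k, (blockFamily cv cv' (Sum.inl b) k : R) * f k = ∑ k, (cv b k : R) * f (Sum.inl k) := by
  rw [Fintype.sum_sum_type]; simp

/-- Row sums, `E'`-rows. [folklore] -/
theorem sum_blockFamily_inr {R : Type*} [CommRing R] (f : γ ⊕ γ' → R) (b : Fin nC') :
    ∑ k, (blockFamily cv cv' (Sum.inr b) k : R) * f k = ∑ k, (cv' b k : R) * f (Sum.inr k) := by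
  rw [Fintype.sum_sum_type]; simp

omit [Fintype γ] [Fintype γ'] in
/-- Column sums, `E`-columns. [folklore] -/
theorem sum_blockFamily_col_inl {R : Type*} [CommRing R] (g : Fin nC ⊕ Fin nC' → R) (k : γ) :
    ∑ b, (blockFamily cv cv' b (Sum.inl k) : R) * g b = ∑ b, (cv b k : R) * g (Sum.inl b) := by
  rw [Fintype.sum_sum_type]; simp

omit [Fintype γ] [Fintype γ'] in
/-- Column sums, `E'`-columns. [folklore] -/
theorem sum_blockFamily_col_inr {R : Type*} [CommRing R] (g : Fin nC ⊕ Fin nC' → R) (k : γ') :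
    ∑ b, (blockFamily cv cv' b (Sum.inr k) : R) * g b = ∑ b, (cv' b k : R) * g (Sum.inr b) := by
  rw [Fintype.sum_sum_type]; simp

omit [Fintype γ] [Fintype γ'] in
/-- **Column sums against blockwise periods**: pairing a column of the block family with periods
of the lattices of the ROWS gives periods of the lattice of the COLUMN (only rows of the same
isotypic block contribute). [folklore] -/
theorem sum_blockFamily_col_lat (L L' : PeriodPair) (f₁ f₂ : PeriodPair → ℂ)
    (a b : Fin nC ⊕ Fin nC' → ℤ) (k : γ ⊕ γ') :
    ∑ b', (blockFamily cv cv' b' k : ℂ) * (a b' * f₁ (lat L L' b') + b b' * f₂ (lat L L' b')) =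
      ((∑ b', blockFamily cv cv' b' k * a b' : ℤ) : ℂ) * f₁ (lat L L' k) +
        ((∑ b', blockFamily cv cv' b' k * b b' : ℤ) : ℂ) * f₂ (lat L L' k) := by
  rcases k with k | k
  · rw [sum_blockFamily_col_inl]
    push_cast
    rw [sum_blockFamily_col_inl, sum_blockFamily_col_inl, Finset.sum_mul, Finset.sum_mul,
      ← Finset.sum_add_distrib]
    refine Finset.sum_congr rfl fun b' _ => ?_
    simp only [lat_inl]; ring
  · rw [sum_blockFamily_col_inr]
    push_cast
    rw [sum_blockFamily_col_inr, sum_blockFamily_col_inr, Finset.sum_mul, Finset.sum_mul,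
      ← Finset.sum_add_distrib]
    refine Finset.sum_congr rfl fun b' _ => ?_
    simp only [lat_inr]; ring

end BlockFamily

/-! ### Coordinates on a connected algebraic subgroup `K₀` -/

section Sub

variable [Fintype β] [Fintype γ] [Fintype γ'] [Fintype δ] {κM : δ → γ ⊕ γ' → Kbar}

/-- **Coordinates of `Lie K₀` presenting `K₀ = H_{(A₀, C₀, C₀', Ξ₀)}` as a two-lattice standard
model**: integer vectors `a⁽ʲ⁾` spanning `A₀^⊥` with an integer left inverse, integer vectors
`m⁽ᵇ⁾` spanning `C₀^⊥ ⊆ ℚ^γ` and `m'⁽ᵇ'⁾` spanning `C₀'^⊥ ⊆ ℚ^{γ'}` with integer left inverses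
(separately on the two isotypic blocks: the abelian subvariety `B × B'` of `E^γ × E'^{γ'}` is
`E^{n_C} × E'^{n_{C'}}`), a linearly independent `ℚ̄`-family `σ⁽ᵉ⁾` spanning `Ξ₀^⊥`, and the
push-out matrix `κ'` of the subgroup over the block family (as `GaGmE.Std.SubData` for one
lattice). [folklore] -/
structure SubData (D₀ : SubgroupData β γ γ' δ κM) where
  /-- number of `𝔾ₘ`-coordinates of `K₀` -/
  nA : ℕ
  /-- the integer vectors `a⁽ʲ⁾ ∈ A₀^⊥` -/
  av : Fin nA → β → ℤ
  av_perp : ∀ q ∈ D₀.A, ∀ j, ∑ i, q i * (av j i : ℚ) = 0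
  av_span : ∀ p : β → ℚ, (∀ q ∈ D₀.A, ∑ i, q i * p i = 0) →
    p ∈ Submodule.span ℚ (Set.range fun j i => (av j i : ℚ))
  /-- the integer left inverse -/
  pA : Fin nA → β → ℤ
  pA_spec : ∀ j j', ∑ i, av j i * pA j' i = if j = j' then 1 else 0
  /-- number of `E`-coordinates of `K₀` -/
  nC : ℕ
  /-- the integer vectors `m⁽ᵇ⁾ ∈ C₀^⊥` -/
  mv : Fin nC → γ → ℤ
  mv_perp : ∀ c ∈ D₀.C, ∀ b, ∑ k, c k * (mv b k : ℚ) = 0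
  mv_span : ∀ p : γ → ℚ, (∀ c ∈ D₀.C, ∑ k, c k * p k = 0) →
    p ∈ Submodule.span ℚ (Set.range fun b k => (mv b k : ℚ))
  /-- the integer left inverse -/
  pC : Fin nC → γ → ℤ
  pC_spec : ∀ b b', ∑ k, mv b k * pC b' k = if b = b' then 1 else 0
  /-- number of `E'`-coordinates of `K₀` -/
  nC' : ℕ
  /-- the integer vectors `m'⁽ᵇ'⁾ ∈ C₀'^⊥` -/
  mv' : Fin nC' → γ' → ℤ
  mv'_perp : ∀ c ∈ D₀.C', ∀ b, ∑ k, c k * (mv' b k : ℚ) = 0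
  mv'_span : ∀ p : γ' → ℚ, (∀ c ∈ D₀.C', ∑ k, c k * p k = 0) →
    p ∈ Submodule.span ℚ (Set.range fun b k => (mv' b k : ℚ))
  /-- the integer left inverse -/
  pC' : Fin nC' → γ' → ℤ
  pC'_spec : ∀ b b', ∑ k, mv' b k * pC' b' k = if b = b' then 1 else 0
  /-- number of vector-group coordinates of `K₀` -/
  nΞ : ℕ
  /-- the `ℚ̄`-vectors `σ⁽ᵉ⁾ ∈ Ξ₀^⊥` -/
  sv : Fin nΞ → δ → Kbar
  sv_perp : ∀ ξ ∈ D₀.Ξ, ∀ e, ∑ x, ξ x * sv e x = 0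
  sv_span : ∀ u : δ → Kbar, (∀ ξ ∈ D₀.Ξ, ∑ x, ξ x * u x = 0) →
    u ∈ Submodule.span Kbar (Set.range sv)
  sv_indep : LinearIndependent Kbar sv
  /-- the push-out matrix `κ'` of the subgroup -/
  κS : Fin nΞ → Fin nC ⊕ Fin nC' → Kbar
  κS_spec : ∀ b x, ∑ k, κM x k * (blockFamily mv mv' b k : Kbar) = ∑ e, κS e b * sv e x

/-- The push-out matrix of the subgroup: `κ ∘ m⁽ᵇ⁾ ∈ Ξ₀^⊥` is a combination of the `σ⁽ᵉ⁾`
(compatibility `ξ ∘ κ ∈ span (C₀ × C₀')` and `m⁽ᵇ⁾ ⊥ C₀ × C₀'`). [folklore] -/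
theorem exists_κS (D₀ : SubgroupData β γ γ' δ κM) {nC nC' : ℕ} (mv : Fin nC → γ → ℤ)
    (mv' : Fin nC' → γ' → ℤ)
    (hmv : ∀ b, ∀ c ∈ prodSub D₀.C D₀.C', ∑ k, c k * (blockFamily mv mv' b k : ℚ) = 0)
    {n : ℕ} {sv : Fin n → δ → Kbar}
    (sv_span : ∀ u ∈ perpK D₀.Ξ, u ∈ Submodule.span Kbar (Set.range sv)) :
    ∃ κS : Fin n → Fin nC ⊕ Fin nC' → Kbar,
      ∀ b x, ∑ k, κM x k * (blockFamily mv mv' b k : Kbar) = ∑ e, κS e b * sv e x := by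
  have hκmem : ∀ b, (fun x => ∑ k, κM x k * (blockFamily mv mv' b k : Kbar)) ∈ perpK D₀.Ξ := by
    intro b ξ hξ
    have hc := D₀.compat ξ hξ
    have key : ∀ lam ∈ Submodule.span Kbar ((fun c : γ ⊕ γ' → ℚ => fun k => (c k : Kbar)) ''
        (prodSub D₀.C D₀.C' : Set (γ ⊕ γ' → ℚ))),
        ∑ k, lam k * (blockFamily mv mv' b k : Kbar) = 0 := by
      intro lam hlam
      induction hlam using Submodule.span_induction with
      | mem x hx =>
        obtain ⟨c, hcC, rfl⟩ := hx
        have h0 : ∑ k, c k * (blockFamily mv mv' b k : ℚ) = 0 := hmv b c hcC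
        have := congrArg (fun r : ℚ => (r : Kbar)) h0
        push_cast at this
        exact this
      | zero => simp
      | add x y _ _ hx hy =>
        simp only [Pi.add_apply, add_mul, Finset.sum_add_distrib, hx, hy, add_zero]
      | smul r x _ hx =>
        simp only [Pi.smul_apply, smul_eq_mul, mul_assoc, ← Finset.mul_sum, hx, mul_zero]
    have h1 := key _ hc
    show ∑ x, ξ x * ∑ k, κM x k * (blockFamily mv mv' b k : Kbar) = 0
    rw [← h1]
    simp only [Finset.mul_sum, Finset.sum_mul]
    rw [Finset.sum_comm]
    exact Finset.sum_congr rfl fun k _ => Finset.sum_congr rfl fun x _ => by ring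
  have hκ : ∀ b, ∃ r : Fin n → Kbar,
      (∑ e, r e • sv e) = fun x => ∑ k, κM x k * (blockFamily mv mv' b k : Kbar) := by
    intro b
    have := sv_span _ (hκmem b)
    rwa [Submodule.mem_span_range_iff_exists_fun] at this
  choose κS hκS using hκ
  refine ⟨fun e b => κS b e, fun b x => ?_⟩
  have := congr_fun (hκS b) x
  simp only [Finset.sum_apply, Pi.smul_apply, smul_eq_mul] at this
  rw [← this]

/-- Adapted coordinates on `K₀` exist. [folklore] -/
theorem nonempty_subData (D₀ : SubgroupData β γ γ' δ κM) : Nonempty (SubData D₀) := by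
  obtain ⟨nA, av, pA, hav, hspanA, hpA⟩ := exists_unimodular_with_leftInverse (perpQ D₀.A)
  obtain ⟨nC, mv, pC, hmv, hspanC, hpC⟩ := exists_unimodular_with_leftInverse (perpQ D₀.C)
  obtain ⟨nC', mv', pC', hmv', hspanC', hpC'⟩ := exists_unimodular_with_leftInverse (perpQ D₀.C')
  obtain ⟨nΞ, sv, sv_mem, sv_span, sv_indep⟩ := exists_sv D₀.Ξ
  have hmvv : ∀ b, ∀ c ∈ prodSub D₀.C D₀.C', ∑ k, c k * (blockFamily mv mv' b k : ℚ) = 0 := by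
    intro b c hc
    obtain ⟨hc1, hc2⟩ := mem_prodSub.mp hc
    rcases b with b | b
    · rw [Fintype.sum_sum_type]
      simp only [blockFamily_inl_inl, blockFamily_inl_inr, Int.cast_zero, mul_zero,
        Finset.sum_const_zero, add_zero]
      exact hmv b _ hc1
    · rw [Fintype.sum_sum_type]
      simp only [blockFamily_inr_inl, blockFamily_inr_inr, Int.cast_zero, mul_zero,
        Finset.sum_const_zero, zero_add]
      exact hmv' b _ hc2
  obtain ⟨κS, hκS⟩ := exists_κS D₀ mv mv' hmvv sv_span
  exact ⟨⟨nA, av, fun q hq j => hav j q hq, fun p hp => hspanA p hp, pA, hpA,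
    nC, mv, fun c hc b => hmv b c hc, fun p hp => hspanC p hp, pC, hpC,
    nC', mv', fun c hc b => hmv' b c hc, fun p hp => hspanC' p hp, pC', hpC',
    nΞ, sv, fun ξ hξ e => sv_mem e ξ hξ, fun u hu => sv_span u hu, sv_indep, κS, hκS⟩⟩

namespace SubData

variable {D₀ : SubgroupData β γ γ' δ κM} (S : SubData D₀)

/-- The index type of the coordinates of `Lie K₀`. [folklore] -/
abbrev σ' : Type := Fin S.nA ⊕ ((Fin S.nC ⊕ Fin S.nC') ⊕ Fin S.nΞ)

/-- The block family `(m⁽ᵇ⁾ | 0), (0 | m'⁽ᵇ'⁾)`. [folklore] -/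
def mvv : Fin S.nC ⊕ Fin S.nC' → γ ⊕ γ' → ℤ := blockFamily S.mv S.mv'

/-- The block family of the left inverses. [folklore] -/
def pCC : Fin S.nC ⊕ Fin S.nC' → γ ⊕ γ' → ℤ := blockFamily S.pC S.pC'

/-- The block family is killed by `C₀ × C₀'`. [folklore] -/
theorem mvv_perp (c : γ ⊕ γ' → ℚ) (hc : c ∈ prodSub D₀.C D₀.C') (b : Fin S.nC ⊕ Fin S.nC') :
    ∑ k, c k * (S.mvv b k : ℚ) = 0 := by
  obtain ⟨hc1, hc2⟩ := mem_prodSub.mp hc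
  rcases b with b | b
  · rw [Fintype.sum_sum_type]
    simp only [mvv, blockFamily_inl_inl, blockFamily_inl_inr, Int.cast_zero, mul_zero,
      Finset.sum_const_zero, add_zero]
    exact S.mv_perp _ hc1 b
  · rw [Fintype.sum_sum_type]
    simp only [mvv, blockFamily_inr_inl, blockFamily_inr_inr, Int.cast_zero, mul_zero,
      Finset.sum_const_zero, zero_add]
    exact S.mv'_perp _ hc2 b

/-- The block family spans `(C₀ × C₀')^⊥` over `ℚ`. [folklore] -/
theorem mvv_span (p : γ ⊕ γ' → ℚ) (hp : ∀ c ∈ prodSub D₀.C D₀.C', ∑ k, c k * p k = 0) :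
    p ∈ Submodule.span ℚ (Set.range fun b k => (S.mvv b k : ℚ)) := by
  have h1 : ∀ c ∈ D₀.C, ∑ k, c k * p (Sum.inl k) = 0 := by
    intro c hc
    have := hp _ (elimL_mem_prodSub (C' := D₀.C') hc)
    rw [Fintype.sum_sum_type] at this
    simpa using this
  have h2 : ∀ c ∈ D₀.C', ∑ k, c k * p (Sum.inr k) = 0 := by
    intro c hc
    have := hp _ (elimR_mem_prodSub (C := D₀.C) hc)
    rw [Fintype.sum_sum_type] at this
    simpa using this
  have hs1 := S.mv_span _ h1
  have hs2 := S.mv'_span _ h2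
  rw [Submodule.mem_span_range_iff_exists_fun] at hs1 hs2
  obtain ⟨r, hr⟩ := hs1
  obtain ⟨r', hr'⟩ := hs2
  have e : p = ∑ b, r b • (fun k => (S.mvv (Sum.inl b) k : ℚ)) +
      ∑ b, r' b • (fun k => (S.mvv (Sum.inr b) k : ℚ)) := by
    funext k
    rcases k with k | k
    · have := congr_fun hr k
      simp only [Finset.sum_apply, Pi.smul_apply, smul_eq_mul] at this
      simp [mvv, Finset.sum_apply, ← this]
    · have := congr_fun hr' k
      simp only [Finset.sum_apply, Pi.smul_apply, smul_eq_mul] at this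
      simp [mvv, Finset.sum_apply, ← this]
  rw [e]
  refine Submodule.add_mem _ ?_ ?_
  · exact Submodule.sum_mem _ fun b _ =>
      Submodule.smul_mem _ _ (Submodule.subset_span ⟨Sum.inl b, rfl⟩)
  · exact Submodule.sum_mem _ fun b _ =>
      Submodule.smul_mem _ _ (Submodule.subset_span ⟨Sum.inr b, rfl⟩)

/-- The left inverse of the block family. [folklore] -/
theorem pCC_spec (b b' : Fin S.nC ⊕ Fin S.nC') :
    ∑ k, S.mvv b k * S.pCC b' k = if b = b' then 1 else 0 := by
  rcases b with b | b <;> rcases b' with b' | b'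
  · rw [Fintype.sum_sum_type]
    simp only [mvv, pCC, blockFamily_inl_inl, blockFamily_inl_inr, mul_zero,
      Finset.sum_const_zero, add_zero, S.pC_spec b b', Sum.inl.injEq]
  · rw [Fintype.sum_sum_type]
    simp [mvv, pCC]
  · rw [Fintype.sum_sum_type]
    simp [mvv, pCC]
  · rw [Fintype.sum_sum_type]
    simp only [mvv, pCC, blockFamily_inr_inl, blockFamily_inr_inr, zero_mul,
      Finset.sum_const_zero, zero_add, S.pC'_spec b b', Sum.inr.injEq]

/-- The embedding `ι : Lie K₀ → Lie M` in adapted coordinates. [folklore] -/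
def ι : (S.σ' → ℂ) →ₗ[ℂ] (β ⊕ ((γ ⊕ γ') ⊕ δ) → ℂ) where
  toFun w := coords (fun i => ∑ j, (S.av j i : ℂ) * w (iy j))
    (fun k => ∑ b, (S.mvv b k : ℂ) * w (iz b))
    (fun x => ∑ e, (S.sv e x : ℂ) * w (is e))
  map_add' v w := by
    funext x
    rcases x with i | k | x
    · simp only [coords, Sum.elim_inl, Pi.add_apply, mul_add, Finset.sum_add_distrib]
    · simp only [coords, Sum.elim_inr, Sum.elim_inl, Pi.add_apply, mul_add,
        Finset.sum_add_distrib]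
    · simp only [coords, Sum.elim_inr, Pi.add_apply, mul_add, Finset.sum_add_distrib]
  map_smul' c w := by
    funext x
    rcases x with i | k | x
    · simp only [coords, Sum.elim_inl, Pi.smul_apply, smul_eq_mul, RingHom.id_apply,
        Finset.mul_sum]
      exact Finset.sum_congr rfl fun i _ => by ring
    · simp only [coords, Sum.elim_inr, Sum.elim_inl, Pi.smul_apply, smul_eq_mul,
        RingHom.id_apply, Finset.mul_sum]
      exact Finset.sum_congr rfl fun i _ => by ring
    · simp only [coords, Sum.elim_inr, Pi.smul_apply, smul_eq_mul, RingHom.id_apply,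
        Finset.mul_sum]
      exact Finset.sum_congr rfl fun i _ => by ring

/-- The `y`-block of `ι`. [folklore] -/
theorem ι_iy (w) (i : β) : S.ι w (iy i) = ∑ j, (S.av j i : ℂ) * w (iy j) := rfl
/-- The `z`-block of `ι`. [folklore] -/
theorem ι_iz (w) (k : γ ⊕ γ') : S.ι w (iz k) = ∑ b, (S.mvv b k : ℂ) * w (iz b) := rfl
/-- The `s`-block of `ι`. [folklore] -/
theorem ι_is (w) (x : δ) : S.ι w (is x) = ∑ e, (S.sv e x : ℂ) * w (is e) := rfl

/-- The integer left inverse on the `y`-block. [folklore] -/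
theorem pA_ι (w : S.σ' → ℂ) (j' : Fin S.nA) : ∑ i, (S.pA j' i : ℂ) * S.ι w (iy i) = w (iy j') := by
  simp only [ι_iy, Finset.mul_sum]
  rw [Finset.sum_comm]
  have key : ∀ j, ∑ i, (S.pA j' i : ℂ) * ((S.av j i : ℂ) * w (iy j)) =
      (if j = j' then 1 else 0) * w (iy j) := by
    intro j
    have h := congrArg (fun n : ℤ => (n : ℂ)) (S.pA_spec j j')
    push_cast at h
    rw [← h, Finset.sum_mul]
    exact Finset.sum_congr rfl fun i _ => by ring
  simp only [key, ite_mul, one_mul, zero_mul, Finset.sum_ite_eq', Finset.mem_univ, if_true]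

/-- The integer left inverse on the `z`-block. [folklore] -/
theorem pC_ι (w : S.σ' → ℂ) (b' : Fin S.nC ⊕ Fin S.nC') :
    ∑ k, (S.pCC b' k : ℂ) * S.ι w (iz k) = w (iz b') := by
  simp only [ι_iz, Finset.mul_sum]
  rw [Finset.sum_comm]
  have key : ∀ b, ∑ k, (S.pCC b' k : ℂ) * ((S.mvv b k : ℂ) * w (iz b)) =
      (if b = b' then 1 else 0) * w (iz b) := by
    intro b
    have h := congrArg (fun n : ℤ => (n : ℂ)) (S.pCC_spec b b')
    push_cast at h
    rw [← h, Finset.sum_mul]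
    exact Finset.sum_congr rfl fun k _ => by ring
  simp only [key, ite_mul, one_mul, zero_mul, Finset.sum_ite_eq', Finset.mem_univ, if_true]

/-- The `σ⁽ᵉ⁾` are linearly independent over `ℂ`. [folklore] -/
theorem eq_zero_of_sv_sum {c : Fin S.nΞ → ℂ} (h : ∀ x, ∑ e, (S.sv e x : ℂ) * c e = 0) : c = 0 := by
  have hind := linearIndependent_ofK (L := ℂ) S.sv_indep
  have := Fintype.linearIndependent_iff.mp hind c (by
    funext x
    simp only [Finset.sum_apply, Pi.smul_apply, smul_eq_mul, Pi.zero_apply,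
      LiePresentation.ofK_apply]
    rw [← h x]
    exact Finset.sum_congr rfl fun e _ => by rw [mul_comm]; rfl)
  exact funext this

/-- `ι` is injective. [folklore] -/
theorem ι_injective : Function.Injective S.ι := by
  rw [← LinearMap.ker_eq_bot, LinearMap.ker_eq_bot']
  intro w hw
  funext t
  rcases t with j' | b' | e'
  · have := S.pA_ι w j'; rw [hw] at this
    show w (iy j') = 0
    simpa using this.symm
  · have := S.pC_ι w b'; rw [hw] at this
    show w (iz b') = 0
    simpa using this.symm
  · have hc : (fun e => w (is e)) = 0 := by
      refine S.eq_zero_of_sv_sum fun x => ?_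
      have := congr_fun hw (is x)
      rw [ι_is] at this
      simpa using this
    exact congr_fun hc e'

/-- The image of `ι` lies in `Lie K₀`. [folklore] -/
theorem ι_mem_tangent (w : S.σ' → ℂ) : S.ι w ∈ D₀.tangent := by
  rw [SubgroupData.mem_tangent_iff]
  refine ⟨fun q hq => ?_, fun c hc => ?_, fun ξ hξ => ?_⟩
  · simp only [ι_iy, Finset.mul_sum]
    rw [Finset.sum_comm]
    refine Finset.sum_eq_zero fun j _ => ?_
    have h := congrArg (fun r : ℚ => (r : ℂ)) (S.av_perp q hq j)
    push_cast at h
    have : ∑ i, (q i : ℂ) * ((S.av j i : ℂ) * w (iy j)) =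
        (∑ i, (q i : ℂ) * (S.av j i : ℂ)) * w (iy j) := by
      rw [Finset.sum_mul]; exact Finset.sum_congr rfl fun i _ => by ring
    rw [this, h, zero_mul]
  · simp only [ι_iz, Finset.mul_sum]
    rw [Finset.sum_comm]
    refine Finset.sum_eq_zero fun b _ => ?_
    have h := congrArg (fun r : ℚ => (r : ℂ)) (S.mvv_perp c hc b)
    push_cast at h
    have : ∑ k, (c k : ℂ) * ((S.mvv b k : ℂ) * w (iz b)) =
        (∑ k, (c k : ℂ) * (S.mvv b k : ℂ)) * w (iz b) := by
      rw [Finset.sum_mul]; exact Finset.sum_congr rfl fun k _ => by ring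
    rw [this, h, zero_mul]
  · simp only [ι_is, Finset.mul_sum]
    rw [Finset.sum_comm]
    refine Finset.sum_eq_zero fun e _ => ?_
    have h := congrArg (algebraMap Kbar ℂ) (S.sv_perp ξ hξ e)
    rw [map_sum, map_zero] at h
    simp only [map_mul] at h
    have : ∑ x, (ξ x : ℂ) * ((S.sv e x : ℂ) * w (is e)) =
        (∑ x, (ξ x : ℂ) * (S.sv e x : ℂ)) * w (is e) := by
      rw [Finset.sum_mul]; exact Finset.sum_congr rfl fun x _ => by ring
    rw [this]
    exact mul_eq_zero_of_left h _

/-- Complex solutions of the `A₀`-equations are combinations of the `a⁽ʲ⁾`. [folklore] -/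
theorem exists_coeff_y {y : β → ℂ} (hy : ∀ q ∈ D₀.A, ∑ i, (q i : ℂ) * y i = 0) :
    ∃ c : Fin S.nA → ℂ, y = fun i => ∑ j, (S.av j i : ℂ) * c j := by
  have hmem : y ∈ solSpace ℚ (L := ℂ) (D₀.A : Set (β → ℚ)) := by
    intro q hq
    simp only [pair, eq_ratCast]
    exact hy q hq
  rw [solSpace_eq_span] at hmem
  have hle : span ℂ (ofK ℚ (L := ℂ) '' {w : β → ℚ | ∀ q ∈ (D₀.A : Set (β → ℚ)), ∑ i, q i * w i = 0}) ≤
      span ℂ (Set.range fun j => fun i => (S.av j i : ℂ)) := by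
    refine span_le.mpr ?_
    rintro _ ⟨w, hw, rfl⟩
    have hw' := S.av_span w hw
    rw [Submodule.mem_span_range_iff_exists_fun] at hw'
    obtain ⟨r, hr⟩ := hw'
    have e : ofK ℚ (L := ℂ) w = ∑ j, (r j : ℂ) • fun i => (S.av j i : ℂ) := by
      funext i
      have := congr_fun hr i
      simp only [Finset.sum_apply, Pi.smul_apply, smul_eq_mul] at this
      simp only [ofK_apply, eq_ratCast, Finset.sum_apply, Pi.smul_apply, smul_eq_mul]
      rw [← this]; push_cast; rfl
    rw [e]
    exact Submodule.sum_mem _ fun j _ => Submodule.smul_mem _ _ (subset_span ⟨j, rfl⟩)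
  have := hle hmem
  rw [Submodule.mem_span_range_iff_exists_fun] at this
  obtain ⟨c, hc⟩ := this
  refine ⟨c, ?_⟩
  funext i
  have := congr_fun hc i
  simp only [Finset.sum_apply, Pi.smul_apply, smul_eq_mul] at this
  rw [← this]
  exact Finset.sum_congr rfl fun j _ => by ring

/-- Complex solutions of the `(C₀ × C₀')`-equations are combinations of the block family.
[folklore] -/
theorem exists_coeff_z {z : γ ⊕ γ' → ℂ} (hz : ∀ c ∈ prodSub D₀.C D₀.C', ∑ k, (c k : ℂ) * z k = 0) :
    ∃ c : Fin S.nC ⊕ Fin S.nC' → ℂ, z = fun k => ∑ b, (S.mvv b k : ℂ) * c b := by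
  have hmem : z ∈ solSpace ℚ (L := ℂ) (prodSub D₀.C D₀.C' : Set (γ ⊕ γ' → ℚ)) := by
    intro c hc
    simp only [pair, eq_ratCast]
    exact hz c hc
  rw [solSpace_eq_span] at hmem
  have hle : span ℂ (ofK ℚ (L := ℂ) ''
      {w : γ ⊕ γ' → ℚ | ∀ c ∈ (prodSub D₀.C D₀.C' : Set (γ ⊕ γ' → ℚ)), ∑ k, c k * w k = 0}) ≤
      span ℂ (Set.range fun b => fun k => (S.mvv b k : ℂ)) := by
    refine span_le.mpr ?_
    rintro _ ⟨w, hw, rfl⟩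
    have hw' := S.mvv_span w hw
    rw [Submodule.mem_span_range_iff_exists_fun] at hw'
    obtain ⟨r, hr⟩ := hw'
    have e : ofK ℚ (L := ℂ) w = ∑ b, (r b : ℂ) • fun k => (S.mvv b k : ℂ) := by
      funext k
      have := congr_fun hr k
      simp only [Finset.sum_apply, Pi.smul_apply, smul_eq_mul] at this
      simp only [ofK_apply, eq_ratCast, Finset.sum_apply, Pi.smul_apply, smul_eq_mul]
      rw [← this]; push_cast; rfl
    rw [e]
    exact Submodule.sum_mem _ fun b _ => Submodule.smul_mem _ _ (subset_span ⟨b, rfl⟩)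
  have := hle hmem
  rw [Submodule.mem_span_range_iff_exists_fun] at this
  obtain ⟨c, hc⟩ := this
  refine ⟨c, ?_⟩
  funext k
  have := congr_fun hc k
  simp only [Finset.sum_apply, Pi.smul_apply, smul_eq_mul] at this
  rw [← this]
  exact Finset.sum_congr rfl fun b _ => by ring

/-- Complex solutions of the `Ξ₀`-equations are combinations of the `σ⁽ᵉ⁾`. [folklore] -/
theorem exists_coeff_s {s : δ → ℂ} (hs : ∀ ξ ∈ D₀.Ξ, ∑ x, (ξ x : ℂ) * s x = 0) :
    ∃ c : Fin S.nΞ → ℂ, s = fun x => ∑ e, (S.sv e x : ℂ) * c e := by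
  have hmem : s ∈ solSpace Kbar (L := ℂ) (D₀.Ξ : Set (δ → Kbar)) := by
    intro ξ hξ
    exact hs ξ hξ
  rw [solSpace_eq_span] at hmem
  have hle : span ℂ (ofK Kbar (L := ℂ) ''
      {w : δ → Kbar | ∀ ξ ∈ (D₀.Ξ : Set (δ → Kbar)), ∑ x, ξ x * w x = 0}) ≤
      span ℂ (Set.range fun e => fun x => (S.sv e x : ℂ)) := by
    refine span_le.mpr ?_
    rintro _ ⟨w, hw, rfl⟩
    have hw' := S.sv_span w hw
    rw [Submodule.mem_span_range_iff_exists_fun] at hw'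
    obtain ⟨r, hr⟩ := hw'
    have e : ofK Kbar (L := ℂ) w = ∑ e, (r e : ℂ) • fun x => (S.sv e x : ℂ) := by
      funext x
      have := congr_fun hr x
      simp only [Finset.sum_apply, Pi.smul_apply, smul_eq_mul] at this
      simp only [ofK_apply, Finset.sum_apply, Pi.smul_apply, smul_eq_mul]
      rw [← this, map_sum]
      exact Finset.sum_congr rfl fun e _ => by rw [map_mul]; rfl
    rw [e]
    exact Submodule.sum_mem _ fun e _ => Submodule.smul_mem _ _ (subset_span ⟨e, rfl⟩)
  have := hle hmem
  rw [Submodule.mem_span_range_iff_exists_fun] at this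
  obtain ⟨c, hc⟩ := this
  refine ⟨c, ?_⟩
  funext x
  have := congr_fun hc x
  simp only [Finset.sum_apply, Pi.smul_apply, smul_eq_mul] at this
  rw [← this]
  exact Finset.sum_congr rfl fun e _ => by ring

/-- **`ι` maps onto `Lie K₀`.** [folklore] -/
theorem exists_eq_ι {w : β ⊕ ((γ ⊕ γ') ⊕ δ) → ℂ} (hw : w ∈ D₀.tangent) : ∃ w', S.ι w' = w := by
  obtain ⟨hA, hC, hΞ⟩ := (SubgroupData.mem_tangent_iff D₀ w).mp hw
  obtain ⟨cy, hcy⟩ := S.exists_coeff_y (y := fun i => w (iy i)) hA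
  obtain ⟨cz, hcz⟩ := S.exists_coeff_z (z := fun k => w (iz k)) hC
  obtain ⟨cs, hcs⟩ := S.exists_coeff_s (s := fun x => w (is x)) hΞ
  refine ⟨coords cy cz cs, ?_⟩
  funext t
  rcases t with i | k | x
  · show S.ι _ (iy i) = w (iy i)
    rw [ι_iy, show w (iy i) = ∑ j, (S.av j i : ℂ) * cy j from congr_fun hcy i]
    rfl
  · show S.ι _ (iz k) = w (iz k)
    rw [ι_iz, show w (iz k) = ∑ b, (S.mvv b k : ℂ) * cz b from congr_fun hcz k]
    rfl
  · show S.ι _ (is x) = w (is x)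
    rw [ι_is, show w (is x) = ∑ e, (S.sv e x : ℂ) * cs e from congr_fun hcs x]
    rfl

/-- The range of `ι` is `Lie K₀`. [folklore] -/
theorem range_ι : LinearMap.range S.ι = D₀.tangent := by
  refine le_antisymm ?_ fun w hw => ?_
  · rintro _ ⟨w', rfl⟩; exact S.ι_mem_tangent w'
  · obtain ⟨w', rfl⟩ := S.exists_eq_ι hw; exact LinearMap.mem_range_self _ _

/-- `dim(model of K₀) = dim K₀`. [folklore] -/
theorem card_eq : Fintype.card S.σ' = finrank ℂ ↥D₀.tangent := by
  rw [← S.range_ι, LinearMap.finrank_range_of_inj S.ι_injective, Module.finrank_fintype_fun_eq_card]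

end SubData

end Sub


section Sub2

variable [Fintype β] [Fintype γ] [Fintype γ'] [Fintype δ] {κM : δ → γ ⊕ γ' → Kbar}

namespace SubData

variable {D₀ : SubgroupData β γ γ' δ κM} (S : SubData D₀)

/-! ### The kernel and the algebraic points -/

/-- `ι` maps `ker(exp)` of the model of `K₀` into `ker(exp_M)`: the `E`-columns of the block
family pair the `E`-rows only, so periods of `Λ` stay periods of `Λ` (and `Λ'` of `Λ'`).
[folklore] -/
theorem ι_mem_ker {L L' : PeriodPair} {w : S.σ' → ℂ} (hw : w ∈ ker L L' S.κS) :
    S.ι w ∈ ker L L' κM := by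
  obtain ⟨hy, a, b, hz, hs⟩ := hw
  choose p hp using hy
  refine ⟨fun i => ⟨∑ j, S.av j i * p j, ?_⟩, fun k => ∑ b', S.mvv b' k * a b',
    fun k => ∑ b', S.mvv b' k * b b', fun k => ?_, fun x => ?_⟩
  · rw [ι_iy]
    push_cast
    rw [Finset.sum_mul]
    exact Finset.sum_congr rfl fun j _ => by rw [hp j]; ring
  · rw [ι_iz]
    have e : ∑ b', (S.mvv b' k : ℂ) * w (iz b') =
        ∑ b', (S.mvv b' k : ℂ) * (a b' * (lat L L' b').ω₁ + b b' * (lat L L' b').ω₂) :=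
      Finset.sum_congr rfl fun b' _ => by rw [hz b']
    rw [e]
    exact sum_blockFamily_col_lat S.mv S.mv' L L' PeriodPair.ω₁ PeriodPair.ω₂ a b k
  · rw [ι_is]
    have hκ : ∀ b' : Fin S.nC ⊕ Fin S.nC', (∑ k, (κM x k : ℂ) * (S.mvv b' k : ℂ)) =
        ∑ e, (S.κS e b' : ℂ) * (S.sv e x : ℂ) := by
      intro b'
      have := congrArg (algebraMap Kbar ℂ) (S.κS_spec b' x)
      simpa [map_sum, map_mul, mvv] using this
    have hcol : ∀ k : γ ⊕ γ', ((∑ b', S.mvv b' k * a b' : ℤ) : ℂ) * (lat L L' k).η₁ +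
        ((∑ b', S.mvv b' k * b b' : ℤ) : ℂ) * (lat L L' k).η₂ =
        ∑ b', (S.mvv b' k : ℂ) * (a b' * (lat L L' b').η₁ + b b' * (lat L L' b').η₂) :=
      fun k => (sum_blockFamily_col_lat S.mv S.mv' L L' PeriodPair.η₁ PeriodPair.η₂ a b k).symm
    simp only [hs, hcol]
    calc ∑ e, (S.sv e x : ℂ) * ∑ b', (S.κS e b' : ℂ) *
          ((a b' : ℂ) * (lat L L' b').η₁ + (b b' : ℂ) * (lat L L' b').η₂)
        = ∑ b', (∑ e, (S.κS e b' : ℂ) * (S.sv e x : ℂ)) *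
            ((a b' : ℂ) * (lat L L' b').η₁ + (b b' : ℂ) * (lat L L' b').η₂) := by
          simp only [Finset.mul_sum, Finset.sum_mul]
          rw [Finset.sum_comm]
          exact Finset.sum_congr rfl fun b' _ => Finset.sum_congr rfl fun e _ => by ring
      _ = ∑ b', (∑ k, (κM x k : ℂ) * (S.mvv b' k : ℂ)) *
            ((a b' : ℂ) * (lat L L' b').η₁ + (b b' : ℂ) * (lat L L' b').η₂) := by
          simp only [hκ]
      _ = ∑ k, (κM x k : ℂ) * ∑ b', (S.mvv b' k : ℂ) *
            ((a b' : ℂ) * (lat L L' b').η₁ + (b b' : ℂ) * (lat L L' b').η₂) := by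
          simp only [Finset.sum_mul, Finset.mul_sum]
          rw [Finset.sum_comm]
          exact Finset.sum_congr rfl fun k _ => Finset.sum_congr rfl fun b' _ => by ring

/-- **Algebraic points of `K₀` with torsion abelian part come from such points of its model.**
[folklore] -/
theorem mem_AlgTors_of_ι {L L' : PeriodPair} (h₂ : IsAlgebraic ℚ L.g₂) (h₃ : IsAlgebraic ℚ L.g₃)
    (h₂' : IsAlgebraic ℚ L'.g₂) (h₃' : IsAlgebraic ℚ L'.g₃)
    {w : S.σ' → ℂ} (hw : S.ι w ∈ AlgTors L L' κM) : w ∈ AlgTors L L' S.κS := by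
  obtain ⟨⟨hy, t, hzt, hs⟩, htor⟩ := hw
  have hwy : ∀ j', w (iy j') = ∑ i, (S.pA j' i : ℂ) * S.ι w (iy i) := fun j' => (S.pA_ι w j').symm
  have hwz : ∀ b', w (iz b') = ∑ k, (S.pCC b' k : ℂ) * S.ι w (iz k) := fun b' => (S.pC_ι w b').symm
  set t'' : Fin S.nC ⊕ Fin S.nC' → ℂ := fun b' => ∑ k, (S.pCC b' k : ℂ) * t k with ht''
  set that : γ ⊕ γ' → ℂ := fun k => ∑ b', (S.mvv b' k : ℂ) * t'' b' with hthat
  have hz'' : ∀ b', (lat L L' b').IsUnivExtAlgPoint (w (iz b')) (t'' b') := by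
    intro b'
    rw [hwz b', ht'']
    dsimp only
    rcases b' with b' | b'
    · rw [show (fun k => (S.pCC (Sum.inl b') k : ℂ) * S.ι w (iz k)) =
          fun k => (blockFamily S.pC S.pC' (Sum.inl b') k : ℂ) * S.ι w (iz k) from rfl,
        sum_blockFamily_inl,
        show (fun k => (S.pCC (Sum.inl b') k : ℂ) * t k) =
          fun k => (blockFamily S.pC S.pC' (Sum.inl b') k : ℂ) * t k from rfl, sum_blockFamily_inl]
      exact PeriodPair.IsUnivExtAlgPoint.sum_int_mul h₂ h₃ _ _ _ _ fun k _ => hzt (Sum.inl k)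
    · rw [show (fun k => (S.pCC (Sum.inr b') k : ℂ) * S.ι w (iz k)) =
          fun k => (blockFamily S.pC S.pC' (Sum.inr b') k : ℂ) * S.ι w (iz k) from rfl,
        sum_blockFamily_inr,
        show (fun k => (S.pCC (Sum.inr b') k : ℂ) * t k) =
          fun k => (blockFamily S.pC S.pC' (Sum.inr b') k : ℂ) * t k from rfl, sum_blockFamily_inr]
      exact PeriodPair.IsUnivExtAlgPoint.sum_int_mul h₂' h₃' _ _ _ _ fun k _ => hzt (Sum.inr k)
  have hzhat : ∀ k, (lat L L' k).IsUnivExtAlgPoint (S.ι w (iz k)) (that k) := by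
    intro k
    rw [ι_iz, hthat]
    dsimp only
    rcases k with k | k
    · rw [show (fun b' => (S.mvv b' (Sum.inl k) : ℂ) * w (iz b')) =
          fun b' => (blockFamily S.mv S.mv' b' (Sum.inl k) : ℂ) * w (iz b') from rfl,
        sum_blockFamily_col_inl,
        show (fun b' => (S.mvv b' (Sum.inl k) : ℂ) * t'' b') =
          fun b' => (blockFamily S.mv S.mv' b' (Sum.inl k) : ℂ) * t'' b' from rfl,
        sum_blockFamily_col_inl]
      exact PeriodPair.IsUnivExtAlgPoint.sum_int_mul h₂ h₃ _ _ _ _ fun b' _ => hz'' (Sum.inl b')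
    · rw [show (fun b' => (S.mvv b' (Sum.inr k) : ℂ) * w (iz b')) =
          fun b' => (blockFamily S.mv S.mv' b' (Sum.inr k) : ℂ) * w (iz b') from rfl,
        sum_blockFamily_col_inr,
        show (fun b' => (S.mvv b' (Sum.inr k) : ℂ) * t'' b') =
          fun b' => (blockFamily S.mv S.mv' b' (Sum.inr k) : ℂ) * t'' b' from rfl,
        sum_blockFamily_col_inr]
      exact PeriodPair.IsUnivExtAlgPoint.sum_int_mul h₂' h₃' _ _ _ _ fun b' _ => hz'' (Sum.inr b')
  have hu : ∀ k, IsAlgebraic ℚ (t k - that k) := by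
    intro k
    have hsub := (hzt k).sub (isAlgebraic_lat_g₂ L L' h₂ h₂' k) (isAlgebraic_lat_g₃ L L' h₃ h₃' k)
      (hzhat k)
    rw [sub_self] at hsub
    exact hsub.isAlgebraic_of_zero
  refine ⟨⟨fun j' => ?_, t'', hz'', fun e' => ?_⟩, fun b' => ?_⟩
  · rw [hwy j', Complex.exp_sum]
    refine Finset.prod_induction _ (fun x => IsAlgebraic ℚ x) (fun a b ha hb => ha.mul hb)
      isAlgebraic_one fun i _ => ?_
    rw [Complex.exp_int_mul]
    exact isAlgebraic_zpow (hy i) _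
  · set W : Fin S.nΞ → ℂ := fun e => w (is e) - ∑ b', (S.κS e b' : ℂ) * t'' b' with hW
    show IsAlgebraic ℚ (W e')
    have hκ : ∀ b' x, (∑ k, (κM x k : ℂ) * (S.mvv b' k : ℂ)) =
        ∑ e, (S.κS e b' : ℂ) * (S.sv e x : ℂ) := by
      intro b' x
      have := congrArg (algebraMap Kbar ℂ) (S.κS_spec b' x)
      simpa [map_sum, map_mul, mvv] using this
    have hthat' : ∀ x, ∑ k, (κM x k : ℂ) * that k =
        ∑ e, (S.sv e x : ℂ) * ∑ b', (S.κS e b' : ℂ) * t'' b' := by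
      intro x
      calc ∑ k, (κM x k : ℂ) * that k = ∑ b', (∑ k, (κM x k : ℂ) * (S.mvv b' k : ℂ)) * t'' b' := by
            simp only [hthat, Finset.mul_sum, Finset.sum_mul]
            rw [Finset.sum_comm]
            exact Finset.sum_congr rfl fun b' _ => Finset.sum_congr rfl fun k _ => by ring
        _ = ∑ b', (∑ e, (S.κS e b' : ℂ) * (S.sv e x : ℂ)) * t'' b' := by simp only [hκ]
        _ = ∑ e, (S.sv e x : ℂ) * ∑ b', (S.κS e b' : ℂ) * t'' b' := by
            simp only [Finset.mul_sum, Finset.sum_mul]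
            rw [Finset.sum_comm]
            exact Finset.sum_congr rfl fun e _ => Finset.sum_congr rfl fun b' _ => by ring
    have hV : ∀ x, ∑ e, (S.sv e x : ℂ) * W e =
        (S.ι w (is x) - ∑ k, (κM x k : ℂ) * t k) + ∑ k, (κM x k : ℂ) * (t k - that k) := by
      intro x
      have e1 : ∑ e, (S.sv e x : ℂ) * W e = S.ι w (is x) - ∑ k, (κM x k : ℂ) * that k := by
        rw [hthat' x, ι_is, ← Finset.sum_sub_distrib]
        exact Finset.sum_congr rfl fun e _ => by rw [hW]; ring
      rw [e1]
      simp only [mul_sub, Finset.sum_sub_distrib]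
      ring
    have hValg : ∀ x, IsAlgebraic ℚ (∑ e, (S.sv e x : ℂ) * W e) := by
      intro x
      rw [hV x]
      refine (hs x).add ?_
      refine Finset.sum_induction _ (fun y => IsAlgebraic ℚ y) (fun a b ha hb => ha.add hb)
        isAlgebraic_zero fun k _ => (isAlgebraic_coe_Kbar (κM x k)).mul (hu k)
    let VK : δ → Kbar := fun x => ⟨∑ e, (S.sv e x : ℂ) * W e, mem_algebraicClosure_iff.mpr (hValg x)⟩
    have hVKx : ∀ x, ((VK x : Kbar) : ℂ) = ∑ e, (S.sv e x : ℂ) * W e := fun x => rfl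
    have hVKmem : VK ∈ kPoints Kbar (span ℂ (ofK Kbar (L := ℂ) '' Set.range S.sv)) := by
      rw [mem_kPoints]
      have hofK : ofK Kbar (L := ℂ) VK = ∑ e, W e • ofK Kbar (L := ℂ) (S.sv e) := by
        funext x
        rw [ofK_apply, show algebraMap Kbar ℂ (VK x) = ((VK x : Kbar) : ℂ) from rfl, hVKx x]
        simp only [Finset.sum_apply, Pi.smul_apply, smul_eq_mul, ofK_apply]
        exact Finset.sum_congr rfl fun e _ => by rw [mul_comm]; rfl
      rw [hofK]
      exact Submodule.sum_mem _ fun e _ =>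
        Submodule.smul_mem _ _ (subset_span ⟨S.sv e, ⟨e, rfl⟩, rfl⟩)
    rw [kPoints_span_ofK, Submodule.mem_span_range_iff_exists_fun] at hVKmem
    obtain ⟨c, hc⟩ := hVKmem
    have hWc : (fun e => W e - (c e : ℂ)) = 0 := by
      refine S.eq_zero_of_sv_sum fun x => ?_
      have h2 : ∑ e, (S.sv e x : ℂ) * (c e : ℂ) = ∑ e, (S.sv e x : ℂ) * W e := by
        rw [← hVKx x, show ((VK x : Kbar) : ℂ) = algebraMap Kbar ℂ (VK x) from rfl,
          ← congr_fun hc x]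
        simp only [Finset.sum_apply, Pi.smul_apply, smul_eq_mul, map_sum, map_mul]
        exact Finset.sum_congr rfl fun e _ => by rw [mul_comm]; rfl
      simp only [mul_sub, Finset.sum_sub_distrib, h2, sub_self]
    have := congr_fun hWc e'
    simp only [Pi.zero_apply, sub_eq_zero] at this
    rw [this]
    exact isAlgebraic_coe_Kbar (c e')
  · rw [hwz b']
    rcases b' with b' | b'
    · rw [show (fun k => (S.pCC (Sum.inl b') k : ℂ) * S.ι w (iz k)) =
          fun k => (blockFamily S.pC S.pC' (Sum.inl b') k : ℂ) * S.ι w (iz k) from rfl,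
        sum_blockFamily_inl]
      exact PeriodPair.IsTorsionPt.sum_int_mul _ _ _ fun k _ => htor (Sum.inl k)
    · rw [show (fun k => (S.pCC (Sum.inr b') k : ℂ) * S.ι w (iz k)) =
          fun k => (blockFamily S.pC S.pC' (Sum.inr b') k : ℂ) * S.ι w (iz k) from rfl,
        sum_blockFamily_inr]
      exact PeriodPair.IsTorsionPt.sum_int_mul _ _ _ fun k _ => htor (Sum.inr k)

/-! ### Rationality and dimensions of `ι⁻¹(𝔟)` -/

/-- The pull-back of a `ℚ̄`-form along `ι`. [folklore] -/
def pullForm (θ : β ⊕ ((γ ⊕ γ') ⊕ δ) → Kbar) : S.σ' → Kbar :=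
  coords (fun j => ∑ i, θ (iy i) * (S.av j i : Kbar)) (fun b => ∑ k, θ (iz k) * (S.mvv b k : Kbar))
    (fun e => ∑ x, θ (is x) * S.sv e x)

/-- `⟨θ, ι w⟩ = ⟨ι^*θ, w⟩`. [folklore] -/
theorem pair_ι (θ : β ⊕ ((γ ⊕ γ') ⊕ δ) → Kbar) (w : S.σ' → ℂ) :
    ∑ t, (θ t : ℂ) * S.ι w t = pair Kbar (S.pullForm θ) w := by
  simp only [pair]
  rw [sum_blocks, sum_blocks]
  have hc : ∀ x : Kbar, algebraMap Kbar ℂ x = (x : ℂ) := fun x => rfl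
  congr 1
  · congr 1
    · simp only [ι_iy, pullForm, coords_iy, map_sum, map_mul, Finset.mul_sum, Finset.sum_mul]
      rw [Finset.sum_comm]
      refine Finset.sum_congr rfl fun j _ => Finset.sum_congr rfl fun i _ => ?_
      simp only [hc]; push_cast; ring
    · simp only [ι_iz, pullForm, coords_iz, map_sum, map_mul, Finset.mul_sum, Finset.sum_mul]
      rw [Finset.sum_comm]
      refine Finset.sum_congr rfl fun b _ => Finset.sum_congr rfl fun k _ => ?_
      simp only [hc]; push_cast; ring
  · simp only [ι_is, pullForm, coords_is, map_sum, map_mul, Finset.mul_sum, Finset.sum_mul]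
    rw [Finset.sum_comm]
    refine Finset.sum_congr rfl fun e _ => Finset.sum_congr rfl fun x _ => ?_
    simp only [hc]; ring

/-- **`ι⁻¹(𝔟)` is `ℚ̄`-rational** for a `ℚ̄`-rational `𝔟`. [folklore] -/
theorem isKRational_comap {𝔟 : Submodule ℂ (β ⊕ ((γ ⊕ γ') ⊕ δ) → ℂ)} (hrat : IsKRational Kbar 𝔟) :
    IsKRational Kbar (𝔟.comap S.ι) := by
  obtain ⟨T, hT⟩ := hrat.dotAnn Kbar
  have h𝔟 : 𝔟 = dotAnn (dotAnn 𝔟) := (dotAnn_dotAnn 𝔟).symm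
  have e : 𝔟.comap S.ι = solSpace Kbar (S.pullForm '' T) := by
    ext w
    rw [Submodule.mem_comap, mem_solSpace]
    constructor
    · intro hw
      rintro _ ⟨θ, hθ, rfl⟩
      rw [← pair_ι]
      have hθ' : ofK Kbar (L := ℂ) θ ∈ dotAnn 𝔟 := by rw [hT]; exact subset_span ⟨θ, hθ, rfl⟩
      have := (mem_dotAnn.mp hθ') (S.ι w) hw
      rw [← this]
      exact Finset.sum_congr rfl fun t _ => by rw [ofK_apply, mul_comm]; rfl
    · intro hw
      rw [h𝔟, mem_dotAnn]
      intro θ hθ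
      rw [hT] at hθ
      induction hθ using Submodule.span_induction with
      | mem x hx =>
        obtain ⟨θ₀, hθ₀, rfl⟩ := hx
        have := hw _ ⟨θ₀, hθ₀, rfl⟩
        rw [← pair_ι] at this
        rw [← this]
        exact Finset.sum_congr rfl fun t _ => by rw [ofK_apply]; rfl
      | zero => simp
      | add x y _ _ hx hy =>
        simp only [Pi.add_apply, add_mul, Finset.sum_add_distrib, hx, hy, add_zero]
      | smul r x _ hx =>
        simp only [Pi.smul_apply, smul_eq_mul, mul_assoc, ← Finset.mul_sum, hx, mul_zero]
  rw [e]
  exact isKRational_solSpace Kbar _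

/-- `ι(ι⁻¹(𝔟)) = 𝔟 ∩ Lie K₀`. [folklore] -/
theorem map_comap (𝔟 : Submodule ℂ (β ⊕ ((γ ⊕ γ') ⊕ δ) → ℂ)) :
    (𝔟.comap S.ι).map S.ι = 𝔟 ⊓ D₀.tangent := by
  rw [Submodule.map_comap_eq, S.range_ι, inf_comm]

/-- `dim ι⁻¹(𝔟) = dim(𝔟 ∩ Lie K₀)`. [folklore] -/
theorem finrank_comap (𝔟 : Submodule ℂ (β ⊕ ((γ ⊕ γ') ⊕ δ) → ℂ)) :
    finrank ℂ ↥(𝔟.comap S.ι) = finrank ℂ ↥(𝔟 ⊓ D₀.tangent) := by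
  rw [← S.map_comap 𝔟]
  exact (Submodule.equivMapOfInjective S.ι S.ι_injective _).finrank_eq

/-! ### Push-forward of subgroups of the model of `K₀` to subgroups of `M` inside `K₀` -/

/-- Evaluation of rational `y`-forms on the `a⁽ʲ⁾`. [folklore] -/
def evA : (β → ℚ) →ₗ[ℚ] (Fin S.nA → ℚ) where
  toFun q := fun j => ∑ i, q i * (S.av j i : ℚ)
  map_add' a b := by funext j; simp [add_mul, Finset.sum_add_distrib]
  map_smul' c a := by funext j; simp [Finset.mul_sum, mul_assoc]

/-- Evaluation of rational `z`-forms of the `E`-block on the `m⁽ᵇ⁾`. [folklore] -/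
def evC : (γ → ℚ) →ₗ[ℚ] (Fin S.nC → ℚ) where
  toFun c := fun b => ∑ k, c k * (S.mv b k : ℚ)
  map_add' a b := by funext j; simp [add_mul, Finset.sum_add_distrib]
  map_smul' c a := by funext j; simp [Finset.mul_sum, mul_assoc]

/-- Evaluation of rational `z`-forms of the `E'`-block on the `m'⁽ᵇ'⁾`. [folklore] -/
def evC' : (γ' → ℚ) →ₗ[ℚ] (Fin S.nC' → ℚ) where
  toFun c := fun b => ∑ k, c k * (S.mv' b k : ℚ)
  map_add' a b := by funext j; simp [add_mul, Finset.sum_add_distrib]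
  map_smul' c a := by funext j; simp [Finset.mul_sum, mul_assoc]

/-- Evaluation of rational `z`-forms on the whole block family. [folklore] -/
def evvC : (γ ⊕ γ' → ℚ) →ₗ[ℚ] (Fin S.nC ⊕ Fin S.nC' → ℚ) where
  toFun c := fun b => ∑ k, c k * (S.mvv b k : ℚ)
  map_add' a b := by
    funext j; simp only [Pi.add_apply, add_mul, Finset.sum_add_distrib]
  map_smul' c a := by
    funext j; simp only [Pi.smul_apply, smul_eq_mul, RingHom.id_apply, Finset.mul_sum, mul_assoc]

/-- `evvC` on the `E`-block. [folklore] -/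
theorem evvC_inl (c : γ ⊕ γ' → ℚ) (b : Fin S.nC) :
    S.evvC c (Sum.inl b) = S.evC (fun k => c (Sum.inl k)) b := by
  simp [evvC, evC, mvv, Fintype.sum_sum_type]

/-- `evvC` on the `E'`-block. [folklore] -/
theorem evvC_inr (c : γ ⊕ γ' → ℚ) (b : Fin S.nC') :
    S.evvC c (Sum.inr b) = S.evC' (fun k => c (Sum.inr k)) b := by
  simp [evvC, evC', mvv, Fintype.sum_sum_type]

/-- **Products are preserved**: `evvC⁻¹(C₁ × C₂) = evC⁻¹(C₁) × evC'⁻¹(C₂)`. [folklore] -/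
theorem prodSub_comap (C₁ : Submodule ℚ (Fin S.nC → ℚ)) (C₂ : Submodule ℚ (Fin S.nC' → ℚ)) :
    prodSub (C₁.comap S.evC) (C₂.comap S.evC') = (prodSub C₁ C₂).comap S.evvC := by
  ext c
  simp only [mem_prodSub, Submodule.mem_comap]
  have e1 : (fun b => S.evvC c (Sum.inl b)) = S.evC (fun k => c (Sum.inl k)) := by
    funext b; rw [evvC_inl]
  have e2 : (fun b => S.evvC c (Sum.inr b)) = S.evC' (fun k => c (Sum.inr k)) := by
    funext b; rw [evvC_inr]
  rw [e1, e2]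

/-- Evaluation of `ℚ̄`-`s`-forms on the `σ⁽ᵉ⁾`. [folklore] -/
def evΞ : (δ → Kbar) →ₗ[Kbar] (Fin S.nΞ → Kbar) where
  toFun θ := fun e => ∑ x, θ x * S.sv e x
  map_add' a b := by funext e; simp [add_mul, Finset.sum_add_distrib]
  map_smul' c a := by funext e; simp [Finset.mul_sum, mul_assoc]

/-- `evΞ` is onto. [folklore] -/
theorem evΞ_surjective : Function.Surjective S.evΞ := by
  classical
  have hker : LinearMap.ker S.evΞ = dotAnn (span Kbar (Set.range S.sv)) := by
    ext θ
    rw [LinearMap.mem_ker, mem_dotAnn]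
    constructor
    · intro h u hu
      induction hu using Submodule.span_induction with
      | mem x hx =>
        obtain ⟨e, rfl⟩ := hx
        have := congr_fun h e
        simp only [evΞ, LinearMap.coe_mk, AddHom.coe_mk, Pi.zero_apply] at this
        rw [← this]
        exact Finset.sum_congr rfl fun x _ => mul_comm _ _
      | zero => simp
      | add x y _ _ hx hy =>
        simp only [Pi.add_apply, add_mul, Finset.sum_add_distrib, hx, hy, add_zero]
      | smul r x _ hx =>
        simp only [Pi.smul_apply, smul_eq_mul, mul_assoc, ← Finset.mul_sum, hx, mul_zero]
    · intro h
      funext e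
      have := h (S.sv e) (subset_span ⟨e, rfl⟩)
      simp only [evΞ, LinearMap.coe_mk, AddHom.coe_mk, Pi.zero_apply]
      rw [← this]
      exact Finset.sum_congr rfl fun x _ => mul_comm _ _
  have hdim : finrank Kbar ↥(span Kbar (Set.range S.sv)) = S.nΞ := by
    rw [finrank_span_eq_card S.sv_indep, Fintype.card_fin]
  have h1 := LinearMap.finrank_range_add_finrank_ker S.evΞ
  have h2 := finrank_dotAnn_add (span Kbar (Set.range S.sv))
  rw [hker] at h1
  rw [hdim] at h2
  rw [Module.finrank_fintype_fun_eq_card] at h1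
  have hr : finrank Kbar ↥(LinearMap.range S.evΞ) = finrank Kbar (Fin S.nΞ → Kbar) := by
    rw [Module.finrank_fintype_fun_eq_card, Fintype.card_fin]; omega
  rw [← LinearMap.range_eq_top]
  exact Submodule.eq_top_of_finrank_eq hr

/-- **A `ℚ̄`-form on the `z`-directions killing the whole block family lies in the `ℚ̄`-span of
`C₀ × C₀'`** (double annihilator). [folklore] -/
theorem form_mem_span_C {ψ : γ ⊕ γ' → Kbar} (hψ : ∀ b, ∑ k, ψ k * (S.mvv b k : Kbar) = 0) :
    ψ ∈ span Kbar ((fun c : γ ⊕ γ' → ℚ => fun k => (c k : Kbar)) ''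
      (prodSub D₀.C D₀.C' : Set (γ ⊕ γ' → ℚ))) := by
  set V : Submodule Kbar (γ ⊕ γ' → Kbar) := span Kbar ((fun c : γ ⊕ γ' → ℚ => fun k => (c k : Kbar)) ''
    (prodSub D₀.C D₀.C' : Set (γ ⊕ γ' → ℚ))) with hV
  rw [← dotAnn_dotAnn V, mem_dotAnn]
  intro u hu
  have hu' : u ∈ solSpace ℚ (L := Kbar) (prodSub D₀.C D₀.C' : Set (γ ⊕ γ' → ℚ)) := by
    intro c hc
    simp only [pair, eq_ratCast]
    exact (mem_dotAnn.mp hu) _ (subset_span ⟨c, hc, rfl⟩)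
  rw [solSpace_eq_span] at hu'
  have hle : span Kbar (ofK ℚ (L := Kbar) ''
      {w : γ ⊕ γ' → ℚ | ∀ c ∈ (prodSub D₀.C D₀.C' : Set (γ ⊕ γ' → ℚ)), ∑ k, c k * w k = 0}) ≤
      span Kbar (Set.range fun b => fun k => (S.mvv b k : Kbar)) := by
    refine span_le.mpr ?_
    rintro _ ⟨w, hw, rfl⟩
    have hw' := S.mvv_span w hw
    rw [Submodule.mem_span_range_iff_exists_fun] at hw'
    obtain ⟨r, hr⟩ := hw'
    have e : ofK ℚ (L := Kbar) w = ∑ b, (r b : Kbar) • fun k => (S.mvv b k : Kbar) := by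
      funext k
      have := congr_fun hr k
      simp only [Finset.sum_apply, Pi.smul_apply, smul_eq_mul] at this
      simp only [ofK_apply, eq_ratCast, Finset.sum_apply, Pi.smul_apply, smul_eq_mul]
      rw [← this]; push_cast; rfl
    rw [e]
    exact Submodule.sum_mem _ fun b _ => Submodule.smul_mem _ _ (subset_span ⟨b, rfl⟩)
  have hu'' := hle hu'
  rw [Submodule.mem_span_range_iff_exists_fun] at hu''
  obtain ⟨r, rfl⟩ := hu''
  simp only [Finset.sum_apply, Pi.smul_apply, smul_eq_mul, Finset.sum_mul]
  rw [Finset.sum_comm]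
  refine Finset.sum_eq_zero fun b _ => ?_
  have : ∑ k, r b * (S.mvv b k : Kbar) * ψ k = r b * ∑ k, ψ k * (S.mvv b k : Kbar) := by
    rw [Finset.mul_sum]; exact Finset.sum_congr rfl fun k _ => by ring
  rw [this, hψ b, mul_zero]

/-- The `ℚ`-linear map `c' ↦ ∑_{b'} c'_{b'} pC⁽ᵇ'⁾` over the block family of left inverses.
[folklore] -/
def pccLin : (Fin S.nC ⊕ Fin S.nC' → ℚ) →ₗ[ℚ] (γ ⊕ γ' → ℚ) where
  toFun c' := fun k => ∑ b', c' b' * (S.pCC b' k : ℚ)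
  map_add' a b := by
    funext i; simp only [Pi.add_apply, add_mul, Finset.sum_add_distrib]
  map_smul' c a := by
    funext i; simp only [Pi.smul_apply, smul_eq_mul, RingHom.id_apply, Finset.mul_sum, mul_assoc]

/-- `evvC ∘ pccLin = id` (the left inverse). [folklore] -/
theorem evvC_pccLin (c' : Fin S.nC ⊕ Fin S.nC' → ℚ) : S.evvC (S.pccLin c') = c' := by
  funext b
  simp only [evvC, pccLin, LinearMap.coe_mk, AddHom.coe_mk, Finset.sum_mul]
  rw [Finset.sum_comm]
  have key : ∀ b', ∑ k, c' b' * (S.pCC b' k : ℚ) * (S.mvv b k : ℚ) =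
      c' b' * (if b = b' then 1 else 0) := by
    intro b'
    have h := congrArg (fun n : ℤ => (n : ℚ)) (S.pCC_spec b b')
    push_cast at h
    rw [← h, Finset.mul_sum]
    exact Finset.sum_congr rfl fun k _ => by ring
  simp only [key, mul_ite, mul_one, mul_zero, Finset.sum_ite_eq, Finset.mem_univ, if_true]

/-- The connected algebraic subgroup of `M` inside `K₀` corresponding to a connected algebraic
subgroup of the model of `K₀`. [folklore] -/
def push (D' : SubgroupData (Fin S.nA) (Fin S.nC) (Fin S.nC') (Fin S.nΞ) S.κS) :
    SubgroupData β γ γ' δ κM where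
  A := D'.A.comap S.evA
  C := D'.C.comap S.evC
  C' := D'.C'.comap S.evC'
  Ξ := D'.Ξ.comap S.evΞ
  compat := by
    intro θ hθ
    rw [Submodule.mem_comap] at hθ
    have hc := D'.compat (S.evΞ θ) hθ
    set φ : γ ⊕ γ' → Kbar := fun k => ∑ x, θ x * κM x k with hφ
    set A : Fin S.nC ⊕ Fin S.nC' → Kbar := fun b' => ∑ k, φ k * (S.mvv b' k : Kbar) with hA
    set Rφ : γ ⊕ γ' → Kbar := fun k' => ∑ b', A b' * (S.pCC b' k' : Kbar) with hRφ
    have hφm : ∀ b', A b' = ∑ e, S.evΞ θ e * S.κS e b' := by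
      intro b'
      rw [hA]
      simp only [hφ, evΞ, LinearMap.coe_mk, AddHom.coe_mk, Finset.sum_mul]
      rw [Finset.sum_comm]
      have hspec := S.κS_spec b'
      simp only [mul_assoc, ← Finset.mul_sum]
      simp only [show ∀ x, ∑ k, κM x k * (S.mvv b' k : Kbar) = ∑ e, S.κS e b' * S.sv e x from
        fun x => hspec x]
      simp only [Finset.mul_sum]
      rw [Finset.sum_comm]
      exact Finset.sum_congr rfl fun e _ => Finset.sum_congr rfl fun x _ => by ring
    have hdiff : ∀ b, ∑ k, (φ k - Rφ k) * (S.mvv b k : Kbar) = 0 := by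
      intro b
      have e2 : ∑ k', Rφ k' * (S.mvv b k' : Kbar) = A b := by
        simp only [hRφ, Finset.sum_mul]
        rw [Finset.sum_comm]
        have key : ∀ b', ∑ k', A b' * (S.pCC b' k' : Kbar) * (S.mvv b k' : Kbar) =
            A b' * (if b = b' then 1 else 0) := by
          intro b'
          have h := congrArg (fun n : ℤ => (n : Kbar)) (S.pCC_spec b b')
          push_cast at h
          rw [← h, Finset.mul_sum]
          exact Finset.sum_congr rfl fun k' _ => by ring
        simp only [key, mul_ite, mul_one, mul_zero, Finset.sum_ite_eq, Finset.mem_univ, if_true]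
      have e1 : ∑ k, (φ k - Rφ k) * (S.mvv b k : Kbar) =
          ∑ k, φ k * (S.mvv b k : Kbar) - ∑ k', Rφ k' * (S.mvv b k' : Kbar) := by
        rw [← Finset.sum_sub_distrib]; exact Finset.sum_congr rfl fun k _ => by ring
      rw [e1, e2]
      exact sub_self _
    have hmono : span Kbar ((fun c : γ ⊕ γ' → ℚ => fun k => (c k : Kbar)) ''
        (prodSub D₀.C D₀.C' : Set (γ ⊕ γ' → ℚ))) ≤
        span Kbar ((fun c : γ ⊕ γ' → ℚ => fun k => (c k : Kbar)) ''
          ((prodSub (D'.C.comap S.evC) (D'.C'.comap S.evC') : Submodule ℚ (γ ⊕ γ' → ℚ)) :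
            Set (γ ⊕ γ' → ℚ))) := by
      refine span_mono (Set.image_mono fun c hc => ?_)
      show c ∈ prodSub (D'.C.comap S.evC) (D'.C'.comap S.evC')
      rw [prodSub_comap, Submodule.mem_comap]
      have : S.evvC c = 0 := by
        funext b
        exact S.mvv_perp c hc b
      rw [this]; exact Submodule.zero_mem _
    have h1 : (fun k => φ k - Rφ k) ∈
        span Kbar ((fun c : γ ⊕ γ' → ℚ => fun k => (c k : Kbar)) ''
          ((prodSub (D'.C.comap S.evC) (D'.C'.comap S.evC') : Submodule ℚ (γ ⊕ γ' → ℚ)) :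
            Set (γ ⊕ γ' → ℚ))) :=
      hmono (S.form_mem_span_C hdiff)
    have h2 : Rφ ∈ span Kbar ((fun c : γ ⊕ γ' → ℚ => fun k => (c k : Kbar)) ''
        ((prodSub (D'.C.comap S.evC) (D'.C'.comap S.evC') : Submodule ℚ (γ ⊕ γ' → ℚ)) :
          Set (γ ⊕ γ' → ℚ))) := by
      have hR : Rφ = ∑ b', (∑ e, S.evΞ θ e * S.κS e b') • fun k' => (S.pCC b' k' : Kbar) := by
        funext k'
        rw [hRφ, Finset.sum_apply]
        exact Finset.sum_congr rfl fun b' _ => by rw [Pi.smul_apply, smul_eq_mul, hφm b']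
      rw [hR]
      have key : ∀ lam ∈ span Kbar ((fun c : Fin S.nC ⊕ Fin S.nC' → ℚ => fun b => (c b : Kbar)) ''
          (prodSub D'.C D'.C' : Set (Fin S.nC ⊕ Fin S.nC' → ℚ))),
          (∑ b', lam b' • fun k' => (S.pCC b' k' : Kbar)) ∈
            span Kbar ((fun c : γ ⊕ γ' → ℚ => fun k => (c k : Kbar)) ''
              ((prodSub (D'.C.comap S.evC) (D'.C'.comap S.evC') : Submodule ℚ (γ ⊕ γ' → ℚ)) :
                Set (γ ⊕ γ' → ℚ))) := by
        intro lam hlam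
        induction hlam using Submodule.span_induction with
        | mem x hx =>
          obtain ⟨c', hc', rfl⟩ := hx
          refine subset_span ⟨S.pccLin c', ?_, ?_⟩
          · show S.pccLin c' ∈ prodSub (D'.C.comap S.evC) (D'.C'.comap S.evC')
            rw [prodSub_comap, Submodule.mem_comap, evvC_pccLin]
            exact hc'
          · funext k'
            simp [pccLin, Finset.sum_apply, Pi.smul_apply]
        | zero => simp
        | add x y _ _ hx hy =>
          simp only [Pi.add_apply, add_smul, Finset.sum_add_distrib]
          exact Submodule.add_mem _ hx hy
        | smul r x _ hx =>
          simp only [Pi.smul_apply, smul_eq_mul, ← smul_smul, ← Finset.smul_sum]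
          exact Submodule.smul_mem _ _ hx
      exact key _ hc
    have hsplit : φ = (fun k => φ k - Rφ k) + Rφ := by
      funext k; simp
    rw [hsplit]
    exact Submodule.add_mem _ h1 h2

/-- `Lie(push K) = ι(Lie K)`. [folklore] -/
theorem push_tangent (D' : SubgroupData (Fin S.nA) (Fin S.nC) (Fin S.nC') (Fin S.nΞ) S.κS) :
    (S.push D').tangent = D'.tangent.map S.ι := by
  classical
  have hCpush : prodSub (S.push D').C (S.push D').C' = (prodSub D'.C D'.C').comap S.evvC :=
    S.prodSub_comap D'.C D'.C'
  refine le_antisymm ?_ ?_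
  · intro w hw
    obtain ⟨hA, hC, hΞ⟩ := (SubgroupData.mem_tangent_iff _ w).mp hw
    rw [hCpush] at hC
    have hw₀ : w ∈ D₀.tangent := by
      rw [SubgroupData.mem_tangent_iff]
      refine ⟨fun q hq => hA q ?_, fun c hc => hC c ?_, fun ξ hξ => hΞ ξ ?_⟩
      · show S.evA q ∈ D'.A
        have : S.evA q = 0 := by
          funext j; simp only [evA, LinearMap.coe_mk, AddHom.coe_mk, Pi.zero_apply]
          exact S.av_perp q hq j
        rw [this]; exact D'.A.zero_mem
      · rw [Submodule.mem_comap]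
        have : S.evvC c = 0 := by
          funext b; exact S.mvv_perp c hc b
        rw [this]; exact Submodule.zero_mem _
      · show S.evΞ ξ ∈ D'.Ξ
        have : S.evΞ ξ = 0 := by
          funext e; simp only [evΞ, LinearMap.coe_mk, AddHom.coe_mk, Pi.zero_apply]
          exact S.sv_perp ξ hξ e
        rw [this]; exact D'.Ξ.zero_mem
    obtain ⟨w', rfl⟩ := S.exists_eq_ι hw₀
    refine ⟨w', ?_, rfl⟩
    show w' ∈ D'.tangent
    rw [SubgroupData.mem_tangent_iff]
    refine ⟨fun q' hq' => ?_, fun c' hc' => ?_, fun ξ' hξ' => ?_⟩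
    · have hq : S.evA (fun i => ∑ j', q' j' * (S.pA j' i : ℚ)) = q' := by
        funext j
        simp only [evA, LinearMap.coe_mk, AddHom.coe_mk, Finset.sum_mul]
        rw [Finset.sum_comm]
        have key : ∀ j', ∑ i, q' j' * (S.pA j' i : ℚ) * (S.av j i : ℚ) =
            q' j' * (if j = j' then 1 else 0) := by
          intro j'
          have h := congrArg (fun n : ℤ => (n : ℚ)) (S.pA_spec j j')
          push_cast at h
          rw [← h, Finset.mul_sum]
          exact Finset.sum_congr rfl fun i _ => by ring
        simp only [key, mul_ite, mul_one, mul_zero, Finset.sum_ite_eq, Finset.mem_univ, if_true]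
      have := hA _ (show S.evA _ ∈ D'.A by rw [hq]; exact hq')
      rw [← this]
      simp only [Rat.cast_sum, Rat.cast_mul, Rat.cast_intCast, Finset.sum_mul]
      rw [Finset.sum_comm]
      refine Finset.sum_congr rfl fun j' _ => ?_
      rw [← S.pA_ι w' j', Finset.mul_sum]
      exact Finset.sum_congr rfl fun i _ => by ring
    · have := hC (S.pccLin c') (by rw [Submodule.mem_comap, evvC_pccLin]; exact hc')
      rw [← this]
      simp only [pccLin, LinearMap.coe_mk, AddHom.coe_mk, Rat.cast_sum, Rat.cast_mul,
        Rat.cast_intCast, Finset.sum_mul]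
      rw [Finset.sum_comm]
      refine Finset.sum_congr rfl fun b' _ => ?_
      rw [← S.pC_ι w' b', Finset.mul_sum]
      exact Finset.sum_congr rfl fun k _ => by ring
    · obtain ⟨θ, hθ⟩ := S.evΞ_surjective ξ'
      have := hΞ θ (show S.evΞ θ ∈ D'.Ξ by rw [hθ]; exact hξ')
      rw [← hθ, ← this]
      simp only [evΞ, LinearMap.coe_mk, AddHom.coe_mk, ι_is, Finset.mul_sum]
      push_cast
      simp only [Finset.sum_mul]
      rw [Finset.sum_comm]
      exact Finset.sum_congr rfl fun x _ => Finset.sum_congr rfl fun e _ => by ring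
  · rintro _ ⟨w', hw', rfl⟩
    obtain ⟨hA, hC, hΞ⟩ := (SubgroupData.mem_tangent_iff _ w').mp hw'
    rw [SubgroupData.mem_tangent_iff, hCpush]
    refine ⟨fun q hq => ?_, fun c hc => ?_, fun θ hθ => ?_⟩
    · have := hA (S.evA q) hq
      simp only [evA, LinearMap.coe_mk, AddHom.coe_mk, Rat.cast_sum, Rat.cast_mul,
        Rat.cast_intCast, Finset.sum_mul] at this
      rw [Finset.sum_comm] at this
      simp only [ι_iy, Finset.mul_sum]
      rw [← this]
      exact Finset.sum_congr rfl fun i _ => Finset.sum_congr rfl fun j _ => by ring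
    · rw [Submodule.mem_comap] at hc
      have := hC (S.evvC c) hc
      simp only [evvC, LinearMap.coe_mk, AddHom.coe_mk, Rat.cast_sum, Rat.cast_mul,
        Rat.cast_intCast, Finset.sum_mul] at this
      rw [Finset.sum_comm] at this
      simp only [ι_iz, Finset.mul_sum]
      rw [← this]
      exact Finset.sum_congr rfl fun k _ => Finset.sum_congr rfl fun b _ => by ring
    · have := hΞ (S.evΞ θ) hθ
      simp only [evΞ, LinearMap.coe_mk, AddHom.coe_mk] at this
      push_cast at this
      simp only [Finset.sum_mul] at this
      rw [Finset.sum_comm] at this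
      simp only [ι_is, Finset.mul_sum]
      rw [← this]
      exact Finset.sum_congr rfl fun x _ => Finset.sum_congr rfl fun e _ => by ring

/-- `Lie(push K) ⊆ Lie K₀`. [folklore] -/
theorem push_tangent_le (D' : SubgroupData (Fin S.nA) (Fin S.nC) (Fin S.nC') (Fin S.nΞ) S.κS) :
    (S.push D').tangent ≤ D₀.tangent := by
  rw [push_tangent, ← S.range_ι]; exact LinearMap.map_le_range

/-! ### The transport theorem (borderline subgroups) -/

/-- **Transport to a borderline subgroup.** Let `𝔟 ⊊ Lie M` be `ℚ̄`-rational and semistable, and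
`0 ≠ K₀ ≠ M` a connected algebraic subgroup which is BORDERLINE for `𝔟`. Then `ι⁻¹(𝔟)` is
`ℚ̄`-rational, proper, and semistable in the model of `K₀` (verbatim from
`GaGmE.Std.SubData.transport`). [cite: BakerWustholz2007, §6.7 (index), §6.8 (p. 115: "B ∩ ker π and ker π")] -/
theorem transport {𝔟 : Submodule ℂ (β ⊕ ((γ ⊕ γ') ⊕ δ) → ℂ)} (hrat : IsKRational Kbar 𝔟) (h𝔟 : 𝔟 ≠ ⊤)
    (hss : Semistable κM 𝔟) (hD₀top : D₀.tangent ≠ ⊤) (hD₀bot : D₀.tangent ≠ ⊥)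
    (hbord : finrank ℂ 𝔟 * (Fintype.card (β ⊕ ((γ ⊕ γ') ⊕ δ)) - finrank ℂ D₀.tangent) =
      (finrank ℂ 𝔟 - finrank ℂ ↥(𝔟 ⊓ D₀.tangent)) * Fintype.card (β ⊕ ((γ ⊕ γ') ⊕ δ))) :
    IsKRational Kbar (𝔟.comap S.ι) ∧ 𝔟.comap S.ι ≠ ⊤ ∧ Semistable S.κS (𝔟.comap S.ι) := by
  set n := Fintype.card (β ⊕ ((γ ⊕ γ') ⊕ δ)) with hn
  set d := finrank ℂ 𝔟 with hd
  set k₀ := finrank ℂ D₀.tangent with hk₀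
  set i₀ := finrank ℂ ↥(𝔟 ⊓ D₀.tangent) with hi₀
  have hcard : Fintype.card S.σ' = k₀ := S.card_eq
  have hdim𝔟' : finrank ℂ ↥(𝔟.comap S.ι) = i₀ := S.finrank_comap 𝔟
  have hdlt : d < n := by have := Submodule.finrank_lt h𝔟; simpa [hn, hd] using this
  have hk₀n : k₀ ≤ n := by have := Submodule.finrank_le D₀.tangent; simpa [hn, hk₀] using this
  have hi₀d : i₀ ≤ d := Submodule.finrank_mono inf_le_left
  have hi₀k : i₀ ≤ k₀ := Submodule.finrank_mono inf_le_right
  have hnpos : 0 < n := by omega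
  have h1 : IsKRational Kbar (𝔟.comap S.ι) := S.isKRational_comap hrat
  have h2 : 𝔟.comap S.ι ≠ ⊤ := by
    intro htop
    have hle : D₀.tangent ≤ 𝔟 := by
      intro w hw
      obtain ⟨w', rfl⟩ := S.exists_eq_ι hw
      have : w' ∈ 𝔟.comap S.ι := by rw [htop]; exact Submodule.mem_top
      exact this
    have h0 := hss.finrank_eq_zero_of_le h𝔟 D₀ hle
    exact hD₀bot (Submodule.finrank_eq_zero.mp h0)
  have h3 : Semistable S.κS (𝔟.comap S.ι) := by
    rintro _ ⟨D', rfl⟩ h𝔨'top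
    set P := (S.push D').tangent with hP
    have hPle : P ≤ D₀.tangent := S.push_tangent_le D'
    have hPeq : P = D'.tangent.map S.ι := S.push_tangent D'
    have hPtop : P ≠ ⊤ := fun h => hD₀top (eq_top_iff.mpr (h ▸ hPle))
    have hssP := hss P ⟨S.push D', rfl⟩ hPtop
    set k := finrank ℂ P with hk
    set i := finrank ℂ ↥(𝔟 ⊓ P) with hi
    have hkeq : finrank ℂ ↥D'.tangent = k := by
      rw [hk, hPeq]; exact (Submodule.equivMapOfInjective S.ι S.ι_injective _).finrank_eq
    have hieq : finrank ℂ ↥(𝔟.comap S.ι ⊓ D'.tangent) = i := by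
      have e1 : (𝔟.comap S.ι ⊓ D'.tangent).map S.ι = 𝔟 ⊓ P := by
        rw [Submodule.map_inf S.ι S.ι_injective, S.map_comap, ← hPeq, inf_assoc,
          inf_eq_right.mpr hPle]
      rw [hi, ← e1]
      exact (Submodule.equivMapOfInjective S.ι S.ι_injective _).finrank_eq
    have hkk₀ : k ≤ k₀ := Submodule.finrank_mono hPle
    have hii₀ : i ≤ i₀ := Submodule.finrank_mono (inf_le_inf_left 𝔟 hPle)
    have hid : i ≤ d := Submodule.finrank_mono inf_le_left
    have hkn : k ≤ n := hkk₀.trans hk₀n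
    rw [hcard, hdim𝔟', hkeq, hieq]
    change d * (n - k) ≤ (d - i) * n at hssP
    have e1 : d * k₀ = i₀ * n := by
      zify [hk₀n, hi₀d] at hbord
      zify
      linear_combination -hbord
    have e2 : i * n ≤ d * k := by
      zify [hkn, hid] at hssP
      zify
      linarith
    have e3 : i * k₀ ≤ i₀ * k := by
      have : n * (i * k₀) ≤ n * (i₀ * k) := by
        calc n * (i * k₀) = k₀ * (i * n) := by ring
          _ ≤ k₀ * (d * k) := Nat.mul_le_mul_left _ e2
          _ = k * (d * k₀) := by ring
          _ = k * (i₀ * n) := by rw [e1]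
          _ = n * (i₀ * k) := by ring
      exact Nat.le_of_mul_le_mul_left this hnpos
    zify [hkk₀, hii₀]
    zify at e3
    nlinarith [e3]
  exact ⟨h1, h2, h3⟩

end SubData

end Sub2

/-! ### The Semistability Theorem (torsion abelian part) from the stable case, by induction -/

section Induction

/-- **The Semistability Theorem for the two-lattice standard models at points with torsion
abelian part, at dimension `n`, by strong induction on `n`, from the STABLE case** (the explicit
hypothesis `hclose`: Baker–Wüstholz's Thm. 6.15 for a `ℚ̄`-rational proper semistable `𝔟` for
which no connected algebraic `0 ≠ K ≠ M` with `ℚ̄`-data is borderline — in print the two runs of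
Baker's method, op. cit. pp. 116–119; for ONE lattice `GaGmE.Std.mem_ker_of_stable`). The
induction is that of `GaGmE.Std.mem_ker_of_semistable_card` verbatim: over a borderline `K₀` pass
to the quotient `M/K₀` (`QuotData.transport`) at all division points `w/m`, conclude `w ∈ Lie K₀`
by discreteness, then pass to the subgroup `K₀` (`SubData.transport`).
[cite: BakerWustholz2007, Thm. 6.15, §6.8 (p. 115: induction over G^* and B ∩ ker π; pp. 116–119)] -/
theorem mem_ker_of_semistable_card {L L' : PeriodPair}
    (hclose : ∀ (β γ γ' δ : Type) [Fintype β] [Fintype γ] [Fintype γ'] [Fintype δ]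
      (κM : δ → γ ⊕ γ' → Kbar) (𝔟 : Submodule ℂ (β ⊕ ((γ ⊕ γ') ⊕ δ) → ℂ)),
      IsKRational Kbar 𝔟 → 𝔟 ≠ ⊤ → Semistable κM 𝔟 →
      (∀ D : SubgroupData β γ γ' δ κM, D.tangent ≠ ⊤ → D.tangent ≠ ⊥ →
        finrank ℂ 𝔟 * (Fintype.card (β ⊕ ((γ ⊕ γ') ⊕ δ)) - finrank ℂ D.tangent) ≠
          (finrank ℂ 𝔟 - finrank ℂ ↥(𝔟 ⊓ D.tangent)) * Fintype.card (β ⊕ ((γ ⊕ γ') ⊕ δ))) →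
      ∀ w ∈ 𝔟, w ∈ AlgTors L L' κM → w ∈ ker L L' κM)
    (h₂ : IsAlgebraic ℚ L.g₂) (h₃ : IsAlgebraic ℚ L.g₃) (h₂' : IsAlgebraic ℚ L'.g₂)
    (h₃' : IsAlgebraic ℚ L'.g₃) (n : ℕ) :
    ∀ (β γ γ' δ : Type) [Fintype β] [Fintype γ] [Fintype γ'] [Fintype δ]
      (κM : δ → γ ⊕ γ' → Kbar) (𝔟 : Submodule ℂ (β ⊕ ((γ ⊕ γ') ⊕ δ) → ℂ)),
      Fintype.card (β ⊕ ((γ ⊕ γ') ⊕ δ)) = n →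
      IsKRational Kbar 𝔟 → 𝔟 ≠ ⊤ → Semistable κM 𝔟 →
      ∀ w ∈ 𝔟, w ∈ AlgTors L L' κM → w ∈ ker L L' κM := by
  induction n using Nat.strong_induction_on with
  | _ n ih =>
  intro β γ γ' δ _ _ _ _ κM 𝔟 hn hrat h𝔟 hss w hw𝔟 hw
  classical
  by_cases hbord : ∃ D : SubgroupData β γ γ' δ κM, D.tangent ≠ ⊤ ∧ D.tangent ≠ ⊥ ∧
      finrank ℂ 𝔟 * (Fintype.card (β ⊕ ((γ ⊕ γ') ⊕ δ)) - finrank ℂ D.tangent) =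
        (finrank ℂ 𝔟 - finrank ℂ ↥(𝔟 ⊓ D.tangent)) * Fintype.card (β ⊕ ((γ ⊕ γ') ⊕ δ))
  · -- a borderline `0 ≠ K₀ ≠ M`: induct over `M/K₀` and `K₀`
    obtain ⟨D₀, hD₀top, hD₀bot, hD₀bord⟩ := hbord
    have hk₀lt : finrank ℂ ↥D₀.tangent < n := by
      have := Submodule.finrank_lt hD₀top; simpa [hn] using this
    -- Step 1: `w ∈ Lie K₀`, through the quotient `M/K₀` at all division points `w/m`
    obtain ⟨Q⟩ := nonempty_quotData D₀
    obtain ⟨hrat', htop', hss'⟩ := Q.transport hrat h𝔟 hss hD₀top hD₀bord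
    have hcard' : Fintype.card Q.σ' < n := by
      have hk₀pos : 0 < finrank ℂ ↥D₀.tangent := by
        rw [Nat.pos_iff_ne_zero, Ne, Submodule.finrank_eq_zero]; exact hD₀bot
      have := Q.card_eq; rw [hn] at this; omega
    have hwD₀ : w ∈ D₀.tangent := by
      refine D₀.mem_tangent_of_forall_exists (L := L) (L' := L') w fun m hm => ?_
      have hwm : (m : ℂ)⁻¹ • w ∈ AlgTors L L' κM := inv_natCast_smul_mem_AlgTors h₂ h₃ h₂' h₃' hw hm
      have hwm𝔟 : (m : ℂ)⁻¹ • w ∈ 𝔟 := Submodule.smul_mem _ _ hw𝔟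
      have hΦ : Q.Φ ((m : ℂ)⁻¹ • w) ∈ ker L L' Q.κM' :=
        ih _ hcard' (Fin Q.nA) (Fin Q.nC) (Fin Q.nC') (Fin Q.nΞ) Q.κM' (𝔟.map Q.Φ) rfl hrat'
          htop' hss' _ (Submodule.mem_map_of_mem hwm𝔟) (Q.Φ_mem_AlgTors h₂ h₃ h₂' h₃' hwm)
      obtain ⟨k, hk, hh⟩ := Q.exists_ker_of_Φ_mem_ker hΦ
      refine ⟨k, hk, (m : ℂ)⁻¹ • w - k, hh, ?_⟩
      have hm0 : (m : ℂ) ≠ 0 := by exact_mod_cast hm.ne'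
      rw [add_sub_cancel, smul_smul, mul_inv_cancel₀ hm0, one_smul]
    -- Step 2: transport to the subgroup `K₀`
    obtain ⟨S⟩ := nonempty_subData D₀
    obtain ⟨hratS, htopS, hssS⟩ := S.transport hrat h𝔟 hss hD₀top hD₀bot hD₀bord
    have hcardS : Fintype.card S.σ' < n := by rw [S.card_eq]; exact hk₀lt
    obtain ⟨w', hw'⟩ := S.exists_eq_ι hwD₀
    have hw'𝔟 : w' ∈ 𝔟.comap S.ι := by show S.ι w' ∈ 𝔟; rw [hw']; exact hw𝔟
    have hw'alg : w' ∈ AlgTors L L' S.κS :=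
      S.mem_AlgTors_of_ι h₂ h₃ h₂' h₃' (by rw [hw']; exact hw)
    have hker' := ih _ hcardS (Fin S.nA) (Fin S.nC) (Fin S.nC') (Fin S.nΞ) S.κS (𝔟.comap S.ι)
      rfl hratS htopS hssS w' hw'𝔟 hw'alg
    rw [← hw']
    exact S.ι_mem_ker hker'
  · -- `𝔟` is stable
    push Not at hbord
    exact hclose β γ γ' δ κM 𝔟 hrat h𝔟 hss (fun D h1 h2 => hbord D h1 h2) w hw𝔟 hw

end Induction

end Std

end GaGmEE

/-! ### The reductions -/

open GaGmEE GaGmEE.Std in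
/-- **The Semistability Theorem for the two-lattice standard models at points with torsion abelian
part follows from its stable case** (both written out in full; D-0026: no named fact).
[cite: BakerWustholz2007, Thm. 6.15, §6.8] -/
theorem GaGmEE.Std.semistabilityTheorem_std_tors_of_stableClosing
    (hclose : ∀ (L L' : PeriodPair), IsAlgebraic ℚ L.g₂ → IsAlgebraic ℚ L.g₃ →
      IsAlgebraic ℚ L'.g₂ → IsAlgebraic ℚ L'.g₃ → ¬ L.HasCM → ¬ L'.HasCM → ¬ L.IsIsogenousTo L' →
      ∀ (β γ γ' δ : Type) [Fintype β] [Fintype γ] [Fintype γ'] [Fintype δ]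
        (κM : δ → γ ⊕ γ' → GaGmE.Kbar) (𝔟 : Submodule ℂ (β ⊕ ((γ ⊕ γ') ⊕ δ) → ℂ)),
        LiePresentation.IsKRational GaGmE.Kbar 𝔟 → 𝔟 ≠ ⊤ → Semistable κM 𝔟 →
        (∀ D : SubgroupData β γ γ' δ κM, D.tangent ≠ ⊤ → D.tangent ≠ ⊥ →
          finrank ℂ 𝔟 * (Fintype.card (β ⊕ ((γ ⊕ γ') ⊕ δ)) - finrank ℂ D.tangent) ≠
            (finrank ℂ 𝔟 - finrank ℂ ↥(𝔟 ⊓ D.tangent)) * Fintype.card (β ⊕ ((γ ⊕ γ') ⊕ δ))) →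
        ∀ w ∈ 𝔟, w ∈ AlgTors L L' κM → w ∈ GaGmEE.Std.ker L L' κM) :
    ∀ (L L' : PeriodPair), IsAlgebraic ℚ L.g₂ → IsAlgebraic ℚ L.g₃ →
      IsAlgebraic ℚ L'.g₂ → IsAlgebraic ℚ L'.g₃ → ¬ L.HasCM → ¬ L'.HasCM → ¬ L.IsIsogenousTo L' →
      ∀ (β γ γ' δ : Type) [Fintype β] [Fintype γ] [Fintype γ'] [Fintype δ]
        (κM : δ → γ ⊕ γ' → GaGmE.Kbar) (𝔟 : Submodule ℂ (β ⊕ ((γ ⊕ γ') ⊕ δ) → ℂ)),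
        LiePresentation.IsKRational GaGmE.Kbar 𝔟 → 𝔟 ≠ ⊤ → Semistable κM 𝔟 →
        ∀ w ∈ 𝔟, w ∈ AlgTors L L' κM → w ∈ GaGmEE.Std.ker L L' κM :=
  fun L L' h₂ h₃ h₂' h₃' hCM hCM' hiso β γ γ' δ _ _ _ _ κM 𝔟 hrat h𝔟 hss w hw𝔟 hw =>
    mem_ker_of_semistable_card (hclose L L' h₂ h₃ h₂' h₃' hCM hCM' hiso) h₂ h₃ h₂' h₃' _
      β γ γ' δ κM 𝔟 rfl hrat h𝔟 hss w hw𝔟 hw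

open GaGmEE GaGmEE.Std in
/-- **Reduction of the ten 1-periods to the STABLE case of the Semistability Theorem for the
two-lattice standard models.** The named fact `HuberWustholzTwoCurvePeriods` (Huber–Wüstholz 2022,
Thm. 15.3 (1) for `[ℤ →⁰ 𝔾ₘ] × E × E'`, `δ = 10`) follows from Baker–Wüstholz's Thm. 6.15 for the
two-lattice standard models `𝔾ₘ^β × P` restricted to STABLE `ℚ̄`-rational proper semistable `𝔟`
(no borderline connected algebraic `0 ≠ K ≠ M`) at the algebraic points of `exp(𝔟_ℂ)` with torsion
abelian part — the statement `hclose`, written out inline (D-0026). Everything between `hclose`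
and the ten periods (the induction over borderline quotients and subgroups, the transport of the
hyperplane theorem to the quotients, the dévissage at the period point, the model
`𝔾ₘ × 𝔾ₐ × (E♮)² × (E'♮)²`) is proved in the tree. What `hclose` still needs is the two runs of
Baker's method on `M` (auxiliary theta polynomial, Siegel, extrapolation, Liouville, the two
dichotomies) closed by Philippon's zero estimate on `M` — the port of the tree's one-lattice
`StableClosing.mem_ker_of_stable`.
[cite: HuberWustholz2022, Thm. 15.3 (1)] [cite: BakerWustholz2007, Thm. 6.15, §6.7, §6.8] -/
theorem HuberWustholzTwoCurvePeriods_of_stableClosing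
    (hclose : ∀ (L L' : PeriodPair), IsAlgebraic ℚ L.g₂ → IsAlgebraic ℚ L.g₃ →
      IsAlgebraic ℚ L'.g₂ → IsAlgebraic ℚ L'.g₃ → ¬ L.HasCM → ¬ L'.HasCM → ¬ L.IsIsogenousTo L' →
      ∀ (β γ γ' δ : Type) [Fintype β] [Fintype γ] [Fintype γ'] [Fintype δ]
        (κM : δ → γ ⊕ γ' → GaGmE.Kbar) (𝔟 : Submodule ℂ (β ⊕ ((γ ⊕ γ') ⊕ δ) → ℂ)),
        LiePresentation.IsKRational GaGmE.Kbar 𝔟 → 𝔟 ≠ ⊤ → Semistable κM 𝔟 →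
        (∀ D : SubgroupData β γ γ' δ κM, D.tangent ≠ ⊤ → D.tangent ≠ ⊥ →
          finrank ℂ 𝔟 * (Fintype.card (β ⊕ ((γ ⊕ γ') ⊕ δ)) - finrank ℂ D.tangent) ≠
            (finrank ℂ 𝔟 - finrank ℂ ↥(𝔟 ⊓ D.tangent)) * Fintype.card (β ⊕ ((γ ⊕ γ') ⊕ δ))) →
        ∀ w ∈ 𝔟, w ∈ AlgTors L L' κM → w ∈ GaGmEE.Std.ker L L' κM) :
    HuberWustholzTwoCurvePeriods :=
  HuberWustholzTwoCurvePeriods_of_std_tors (semistabilityTheorem_std_tors_of_stableClosing hclose)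

end Literature.NumberTheory.Transcendental

end
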